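import Mathlib
import Literature.NumberTheory.LFunctions.Zhang2022.Section8aStatements
import Literature.NumberTheory.LFunctions.Zhang2022.Section3Lemma33
import Literature.NumberTheory.LFunctions.Zhang2022.Section7Eq75Majorants
import Literature.NumberTheory.LFunctions.Zhang2022.Section5Lemma51
import Literature.NumberTheory.LFunctions.Zhang2022.SkeletonBlanketA
import HarnessLib

/-!
# Zhang (2022), §8 p. 43: the step `Z22:§8.u013` of the proof of Lemma 8.1, DISCHARGED given Lemma 6.1

Topic `Literature/NumberTheory/LFunctions/Zhang2022` (Landau–Siegel adjudication tree; verdict-neutral).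
Y. Zhang, *Discrete mean estimates and the Landau–Siegel zero*, arXiv:2211.02515v1 (2022)
[Zhang2022LandauSiegel] — **an unrefereed manuscript under adjudication; nothing in this file asserts
or denies its Theorems 1–2.** Campaign D-0069 (L2, row `Section8aStatements`), the typed claim

> `Z22:§8.u013` (p. 43, tex L2244–2247): "By Cauchy's inequality, Lemma 6.1, and the second
> assertion of Lemma 3.3, for `s ∈ 𝔍(α)`, `Σ_{ψ∈Ψ₁} |L(s+β₂,ψ)L(s+β₃,ψ)|² ≪ P²𝓛³⁶`"

(`Section8aStatements.Step8u013 c′`) is PROVED here from the cone leaf **Lemma 6.1**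
(`Skeleton.Lemma61`, entering as a HYPOTHESIS — it is not re-proved) and theorems of the tree:

* `step8u013_ofA : Skeleton.Lemma61A → Step8u013 c′` (the print-faithful (A)-form of Lemma 6.1,
  which is what the §6 discharge chain `Section6Statements.lemma61A_of_steps` delivers);
* `step8u013_of : Skeleton.Lemma61 → Step8u013 c′` (the banked, unconditional node; a corollary).

## The argument (the manuscript's own (7.5) chain, at fourth moments)

`|L₂L₃|² ≤ ½(|L₂|⁴ + |L₃|⁴)`; for `w = s + β_j` (`Re w = 1/2 + α`, `|Im w − 2πt₀| ≤ 𝓛₁ + b_j < 𝓛₁ + 2`)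
Lemma 6.1 gives `|L(w,ψ)| ≤ |K(w,ψ)| + |Z(w,ψ)||N(1−w,ψ̄)| + C(E₁(w,ψ) + ε)` with `|Z| ≤ e¹³`
(`GammaFactor.norm_Zfac_le_exp_of_abs_sub_half_le`, Stirling), so `|L|⁴ ≤ 64(|K|⁴ + e⁵²|N|⁴ + C⁴E₁⁴ + C⁴ε⁴)`.
Each of `K`, `N̄` and the inner sum of `E₁` is a truncated Dirichlet polynomial of length `< P`
(`2P₄ ≤ P`, `2T² ≤ P`, `T³ ≤ P` for large `D`) with coefficients `≤ 1`; its SQUARE has length `≤ P²`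
and coefficients `|a′⋆a′| ≤ τ₂` (`Section7Eq75.sq_dirPoly_eq`), so the large sieve (Lemma 3.3 (ii) over
any finite subfamily of `Ψ`, `Skeleton.lemma33b_sum_le`) and `Σ_{m≤P²} τ₂(m)²/m ≪ (log P²)⁴`
(`MeanSquareMajorant.sum_norm_seqConv_sq_div_le`) give `Σ_ψ |·|⁴ ≪ P²(log P²)⁴ ≪ P²𝓛³⁶`; the weights
are `n^{−1−2α} ≤ n⁻¹` at `σ = 1/2 + α` and `n^{2α−1} ≤ e^{4π}n⁻¹` (`n ≤ P²`, `α log P = π`) at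
`σ = 1/2 − α` (the conjugate `N̄`). For `E₁⁴`, Hölder in `v` (`(∫_{−𝓛²⁰}^{𝓛²⁰} f)⁴ ≤ (2𝓛²⁰)³∫f⁴`,
Mathlib's `integral_mul_le_Lp_mul_Lq_of_nonneg`), the finite sum over `ψ` taken inside the integral,
and the large sieve pointwise in `v`; the prefactor `𝓛⁻²⁷²(2𝓛²⁰)⁴ ≤ 16`. The `ε⁴`-term uses
`#Ψ₁ ≤ 𝔓 ≤ 4P²` (`cardPsiOneLe_holds`, `frakP_bounds`). All "for large `D`" comparisons of the
parameters (`2𝓛⁵¹⁹ ≤ e^{2𝓛^{1.1}}` etc.) are obtained from Mathlib's asymptotics along `𝓛 = log D → ∞`.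

Theorem-only: no definitions, no new named facts. WHAT THIS IS NOT: any statement about
Theorems 1–2 of the source or about Landau–Siegel zeros; Lemma 6.1 remains a hypothesis.

## References

* Y. Zhang, arXiv:2211.02515v1 (2022), §8 p. 43 (tex L2244–2247); §6 Lemma 6.1 p. 30; §3 Lemma 3.3
  p. 14; §7 (7.5) p. 35. [cite: Zhang2022LandauSiegel, §8 p.43]
-/

noncomputable section

open Complex Real ComplexConjugate Filter MeasureTheory

namespace Literature.NumberTheory.LFunctions.Zhang2022.Section8aStatements

open Skeleton MeanSquareMajorant Section7Eq75

/-! ## A. "For all large `D`": parameter bookkeeping -/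

/-- `𝓛 = log D → ∞`. [cite: Zhang2022LandauSiegel, §2 (2.1)] -/
private theorem tendsto_ell : Tendsto (fun D : ℕ => ell D) atTop atTop :=
  Real.tendsto_log_atTop.comp tendsto_natCast_atTop_atTop

/-- An eventual property of `𝓛` holds "for `D` greater than a sufficiently large number".
[cite: Zhang2022LandauSiegel, §2 p.4] -/
private theorem eventually_ell {p : ℝ → Prop} (h : ∀ᶠ L in atTop, p L) :
    ∃ D₀ : ℕ, ∀ D : ℕ, D₀ ≤ D → p (ell D) :=
  Filter.eventually_atTop.mp (tendsto_ell.eventually h)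

/-- `2t₀ ≤ T²` for large `D` (`2𝓛⁵¹⁹ ≤ exp(2𝓛^{1.1})`; polynomial versus exponential growth).
[cite: Zhang2022LandauSiegel, §2 (2.8); §6 p.30] -/
private theorem eventually_two_t0_le : ∃ D₀ : ℕ, ∀ D : ℕ, D₀ ≤ D → 2 * t0 D ≤ bigT D ^ 2 := by
  have h1 : ∀ᶠ L : ℝ in atTop, ‖L ^ 519‖ ≤ 1 / 2 * ‖Real.exp (2 * L)‖ :=
    (isLittleO_pow_exp_pos_mul_atTop 519 (by norm_num : (0 : ℝ) < 2)).bound (by norm_num)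
  have h2 : ∀ᶠ L : ℝ in atTop, 1 ≤ L := eventually_ge_atTop 1
  obtain ⟨D₀, h⟩ := eventually_ell (h1.and h2)
  refine ⟨D₀, fun D hD => ?_⟩
  obtain ⟨ha, hb⟩ := h D hD
  rw [Real.norm_of_nonneg (by positivity), Real.norm_of_nonneg (Real.exp_pos _).le] at ha
  have hc : Real.exp (2 * ell D) ≤ Real.exp (2 * ell D ^ (1.1 : ℝ)) := by
    apply Real.exp_le_exp.mpr
    have := Real.self_le_rpow_of_one_le hb (by norm_num : (1 : ℝ) ≤ 1.1)
    linarith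
  rw [t0, bigT, ← Real.exp_nat_mul]
  push_cast
  linarith

/-- `𝓛 ≥ 3`, `2T² ≤ P`, `T³ ≤ P`, `2 ≤ ⌊P²⌋` for large `D` (`T = exp 𝓛^{1.1}`, `P = exp 𝓛⁹`).
[cite: Zhang2022LandauSiegel, §2 (2.6); §6 p.30] -/
private theorem eventually_sizes : ∃ D₀ : ℕ, ∀ D : ℕ, D₀ ≤ D →
    3 ≤ ell D ∧ 2 * bigT D ^ 2 ≤ bigP D ∧ bigT D ^ 3 ≤ bigP D ∧ 2 ≤ ⌊bigP D ^ 2⌋₊ := by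
  obtain ⟨D₀, h⟩ := eventually_ell (eventually_ge_atTop (3 : ℝ))
  refine ⟨D₀, fun D hD => ?_⟩
  have hL : 3 ≤ ell D := h D hD
  have hL1 : 1 ≤ ell D := by linarith
  have h11 : ell D ^ (1.1 : ℝ) ≤ ell D ^ 2 := by
    have := Real.rpow_le_rpow_of_exponent_le hL1 (by norm_num : (1.1 : ℝ) ≤ 2)
    rwa [Real.rpow_two] at this
  have h9 : ell D ^ 9 = ell D ^ 2 * ell D ^ 7 := by ring
  have h7 : (3 : ℝ) ^ 7 ≤ ell D ^ 7 := pow_le_pow_left₀ (by norm_num) hL 7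
  have h2sq : (9 : ℝ) ≤ ell D ^ 2 := by nlinarith
  have hkey : Real.log 2 + 2 * ell D ^ (1.1 : ℝ) ≤ ell D ^ 9 := by
    rw [h9]; nlinarith [Real.log_two_lt_d9]
  have hkey' : 3 * ell D ^ (1.1 : ℝ) ≤ ell D ^ 9 := by
    rw [h9]; nlinarith
  have hP : 2 * bigT D ^ 2 ≤ bigP D := by
    rw [bigT, bigP, ← Real.exp_nat_mul]
    have : (2 : ℝ) * Real.exp ((2 : ℕ) * ell D ^ (1.1 : ℝ)) =
        Real.exp (Real.log 2 + 2 * ell D ^ (1.1 : ℝ)) := by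
      rw [Real.exp_add, Real.exp_log two_pos]; push_cast; ring
    rw [this]
    exact Real.exp_le_exp.mpr hkey
  have hP2 : bigT D ^ 3 ≤ bigP D := by
    rw [bigT, bigP, ← Real.exp_nat_mul]
    push_cast
    exact Real.exp_le_exp.mpr hkey'
  refine ⟨hL, hP, hP2, ?_⟩
  have h2P : (2 : ℝ) ≤ bigP D ^ 2 := by
    have h1 : (1 : ℝ) ≤ bigT D ^ 2 := one_le_pow₀ (Real.one_lt_exp_iff.2 (by positivity)).le
    have hP0 : 0 ≤ bigP D := (Real.exp_pos _).le
    nlinarith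
  exact Nat.le_floor (by exact_mod_cast h2P)


/-! ## B. The fourth moment of a truncated Dirichlet polynomial over a subfamily of `Ψ` -/

/-- **`Σ_{ψ∈T} |Σ_{n<N} a(n)ψ(n)n^{−w}|⁴ ≤ C·P²·E·B⁴(log P²)⁴`** for `(N−1)² ≤ P²`, `|a| ≤ B`, and a
weight bound `n^{−2σ} ≤ E/n` on `n ≤ P²`: the square is a Dirichlet polynomial of length `≤ P²` with
coefficients `|a′⋆a′| ≤ B²τ₂` (`Section7Eq75.sq_dirPoly_eq`), to which the large sieve (Lemma 3.3 (ii),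
`Skeleton.lemma33b_sum_le`) and `Σ_{m≤X} τ₂(m)²/m ≪ (log X)⁴` (`MeanSquareMajorant.sum_norm_seqConv_sq_div_le`)
apply — the chain of (7.5). [cite: Zhang2022LandauSiegel, §7 (7.5) p.35, tex L1904; §8 p.43, tex L2244–2247] -/
private theorem fourth_moment_le {D : ℕ} (T : Finset (Chr D)) {N : ℕ}
    (hN : (N - 1) * (N - 1) ≤ ⌊bigP D ^ 2⌋₊) (h2 : 2 ≤ ⌊bigP D ^ 2⌋₊)
    (a : ℕ → ℂ) {B : ℝ} (ha : ∀ n, ‖a n‖ ≤ B) (w : ℂ) {E : ℝ}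
    (hE : ∀ k ∈ Finset.Icc 1 ⌊bigP D ^ 2⌋₊, (k : ℝ) ^ (-2 * w.re) ≤ E * (k : ℝ)⁻¹) :
    ∑ x ∈ T, ‖∑ n ∈ Finset.Ico 1 N, a n * x.ψ (n : ZMod x.p) * (n : ℂ) ^ (-w)‖ ^ 4 ≤
      (2 + 2 * (3 + (Real.log 2 ^ 68)⁻¹) ^ 2) * bigP D ^ 2 *
        (E * ((max B 0) ^ 4 * (majorantConst 4 4 * Real.log (⌊bigP D ^ 2⌋₊ : ℝ) ^ 4))) := by
  classical
  set K := ⌊bigP D ^ 2⌋₊ with hKdef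
  set a' : ℕ → ℂ := fun n => if n < N then a n else 0 with ha'def
  have ha' : ∀ n, n ≠ 0 → ‖a' n‖ ≤ max B 0 := fun n _ => norm_truncSeq_le ha n
  -- the square of the polynomial is a polynomial of length `≤ K` with coefficients `a′ ⋆ a′`
  have hsq : ∀ x : Chr D,
      (∑ n ∈ Finset.Ico 1 N, a n * x.ψ (n : ZMod x.p) * (n : ℂ) ^ (-w)) ^ 2 =
        ∑ k ∈ Finset.Icc 1 K, seqConv a' a' k * x.ψ (k : ZMod x.p) * (k : ℂ) ^ (-w) := by
    intro x
    have hθ0 : x.ψ ((0 : ℕ) : ZMod x.p) = 0 := by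
      rw [Nat.cast_zero]; exact MulChar.map_zero _
    have hθ : ∀ m n : ℕ, x.ψ ((m * n : ℕ) : ZMod x.p) = x.ψ (m : ZMod x.p) * x.ψ (n : ZMod x.p) := by
      intro m n; rw [Nat.cast_mul, map_mul]
    rw [← sq_dirPoly_eq N K hN a (fun n => x.ψ (n : ZMod x.p)) hθ0 hθ w]
    congr 1
    rcases Nat.eq_zero_or_pos N with hN0 | hNpos
    · subst hN0; simp
    · rw [Finset.range_eq_Ico, Finset.sum_eq_sum_Ico_succ_bot hNpos, hθ0]; simp
  have hC : (0 : ℝ) ≤ (2 + 2 * (3 + (Real.log 2 ^ 68)⁻¹) ^ 2) * bigP D ^ 2 := by positivity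
  calc ∑ x ∈ T, ‖∑ n ∈ Finset.Ico 1 N, a n * x.ψ (n : ZMod x.p) * (n : ℂ) ^ (-w)‖ ^ 4
      = ∑ x ∈ T, ‖∑ k ∈ Finset.Icc 1 K, seqConv a' a' k * x.ψ (k : ZMod x.p) * (k : ℂ) ^ (-w)‖ ^ 2 := by
        refine Finset.sum_congr rfl fun x _ => ?_
        rw [← hsq x, norm_pow]; ring
    _ ≤ (2 + 2 * (3 + (Real.log 2 ^ 68)⁻¹) ^ 2) * bigP D ^ 2 *
          ∑ k ∈ Finset.Icc 1 K, ‖seqConv a' a' k‖ ^ 2 * (k : ℝ) ^ (-2 * w.re) :=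
        lemma33b_sum_le T w (seqConv a' a')
    _ ≤ (2 + 2 * (3 + (Real.log 2 ^ 68)⁻¹) ^ 2) * bigP D ^ 2 *
          ∑ k ∈ Finset.Icc 1 K, ‖seqConv a' a' k‖ ^ 2 * (E * (k : ℝ)⁻¹) := by
        apply mul_le_mul_of_nonneg_left _ hC
        exact Finset.sum_le_sum fun k hk => mul_le_mul_of_nonneg_left (hE k hk) (sq_nonneg _)
    _ = (2 + 2 * (3 + (Real.log 2 ^ 68)⁻¹) ^ 2) * bigP D ^ 2 *
          (E * ∑ k ∈ Finset.Icc 1 K, ‖seqConv a' a' k‖ ^ 2 / k) := by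
        congr 1
        rw [Finset.mul_sum]
        exact Finset.sum_congr rfl fun k _ => by rw [div_eq_mul_inv]; ring
    _ ≤ (2 + 2 * (3 + (Real.log 2 ^ 68)⁻¹) ^ 2) * bigP D ^ 2 *
          (E * ((max B 0) ^ 4 * (majorantConst 4 4 * Real.log (K : ℝ) ^ 4))) := by
        apply mul_le_mul_of_nonneg_left _ hC
        have hE0 : 0 ≤ E := by
          have h1 : 1 ∈ Finset.Icc 1 K := Finset.mem_Icc.mpr ⟨le_rfl, by omega⟩
          have := hE 1 h1
          simp at this
          linarith
        exact mul_le_mul_of_nonneg_left (sum_norm_seqConv_sq_div_le ha' h2) hE0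

/-- `K(w,ψ)` as a truncated Dirichlet polynomial `Σ_{n<2P₄} g*(P₄/n)ψ(n)n^{−w}`.
[cite: Zhang2022LandauSiegel, §6 Lemma 6.1 p.30] -/
private theorem Kchar_eq (D : ℕ) (x : Chr D) (w : ℂ) :
    Kchar D (psiFn x) w = ∑ n ∈ Finset.Ico 1 ⌈2 * P4 D⌉₊,
      (gstar D (P4 D / n) : ℂ) * x.ψ (n : ZMod x.p) * (n : ℂ) ^ (-w) := by
  rw [Kchar]
  exact Finset.sum_congr rfl fun n _ => by simp only [psiFn]; ring

/-- `N(w,ψ)` as a truncated Dirichlet polynomial `Σ_{n<2T²} g*(T²/n)ψ(n)n^{−w}`.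
[cite: Zhang2022LandauSiegel, §6 Lemma 6.1 p.30] -/
private theorem Nchar_eq (D : ℕ) (x : Chr D) (w : ℂ) :
    Nchar D (psiFn x) w = ∑ n ∈ Finset.Ico 1 ⌈2 * bigT D ^ 2⌉₊,
      (gstar D (bigT D ^ 2 / n) : ℂ) * x.ψ (n : ZMod x.p) * (n : ℂ) ^ (-w) := by
  rw [Nchar]
  exact Finset.sum_congr rfl fun n _ => by simp only [psiFn]; ring

/-- `|g*(y)| ≤ 1` (`0 < g < 1`, `GaussWeight.gWeight_pos/lt_one`). [cite: Zhang2022LandauSiegel, §6 p.30] -/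
private theorem norm_gstar_le {D : ℕ} (hℓ : 0 < ell D) (y : ℝ) : ‖(gstar D y : ℂ)‖ ≤ 1 := by
  rw [Complex.norm_real, Real.norm_eq_abs, gstar]
  split_ifs
  · have h30 : 0 < ell D ^ 30 := by positivity
    rw [gW, abs_of_pos (GaussWeight.gWeight_pos h30 _)]
    exact (GaussWeight.gWeight_lt_one h30 _).le
  · simp

/-- `\overline{n^{s}} = n^{s̄}` for a natural number `n`. [folklore] -/
private theorem conj_natCast_cpow' (n : ℕ) (s : ℂ) : conj ((n : ℂ) ^ s) = (n : ℂ) ^ conj s := by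
  have h := Complex.conj_cpow (n : ℂ) (conj s) (by rw [Complex.natCast_arg]; exact Real.pi_ne_zero.symm)
  rw [Complex.conj_conj, Complex.conj_natCast] at h
  exact h.symm

/-- `|N(w,ψ̄)| = |N(w̄,ψ)|` (conjugation; the weights `g*` are real).
[cite: Zhang2022LandauSiegel, §6 Lemma 6.1 p.30] -/
private theorem norm_Nchar_bar (D : ℕ) (x : Chr D) (w : ℂ) :
    ‖Nchar D (psiBarFn x) w‖ = ‖Nchar D (psiFn x) (conj w)‖ := by
  rw [← Complex.norm_conj (Nchar D (psiBarFn x) w)]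
  congr 1
  rw [Nchar, Nchar, map_sum]
  refine Finset.sum_congr rfl fun n _ => ?_
  rw [map_mul, map_mul, conj_natCast_cpow', map_neg, Complex.conj_ofReal]
  simp only [psiBarFn, psiFn, Complex.conj_conj]

/-- The weight at `σ = 1/2 + α`: `n^{−2σ} ≤ n⁻¹`. [cite: Zhang2022LandauSiegel, §8 p.43] -/
private theorem weight_half_add {D : ℕ} (hα : 0 ≤ alpha D) {w : ℂ} (hw : w.re = 1 / 2 + alpha D)
    (k : ℕ) (hk : k ∈ Finset.Icc 1 ⌊bigP D ^ 2⌋₊) : (k : ℝ) ^ (-2 * w.re) ≤ 1 * (k : ℝ)⁻¹ := by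
  have hk1 : (1 : ℝ) ≤ k := by exact_mod_cast (Finset.mem_Icc.mp hk).1
  rw [hw, one_mul, ← Real.rpow_neg_one]
  exact Real.rpow_le_rpow_of_exponent_le hk1 (by linarith)

/-- The weight at `σ = 1/2 − α`: `n^{−2σ} = n^{2α}n⁻¹ ≤ (P²)^{2α}n⁻¹ = e^{4π}n⁻¹` for `n ≤ P²`
(`α log P = π`). [cite: Zhang2022LandauSiegel, §2 (2.10); §8 p.43] -/
private theorem weight_half_sub {D : ℕ} (hℓ : 0 < ell D) {u : ℂ} (hu : u.re = 1 / 2 - alpha D)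
    (k : ℕ) (hk : k ∈ Finset.Icc 1 ⌊bigP D ^ 2⌋₊) :
    (k : ℝ) ^ (-2 * u.re) ≤ Real.exp (4 * π) * (k : ℝ)⁻¹ := by
  obtain ⟨hk1, hkK⟩ := Finset.mem_Icc.mp hk
  have hk0 : (0 : ℝ) < k := by exact_mod_cast hk1
  have hkP : (k : ℝ) ≤ bigP D ^ 2 :=
    le_trans (by exact_mod_cast hkK) (Nat.floor_le (by positivity))
  have hα : alpha D = π / ell D ^ 9 := by rw [alpha, bigP, Real.log_exp]
  have hα0 : 0 ≤ alpha D := by rw [hα]; positivity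
  rw [hu, show -2 * (1 / 2 - alpha D) = 2 * alpha D + (-1) by ring, Real.rpow_add hk0,
    Real.rpow_neg_one]
  apply mul_le_mul_of_nonneg_right _ (inv_nonneg.mpr hk0.le)
  have h9 : ell D ^ 9 ≠ 0 := by positivity
  calc (k : ℝ) ^ (2 * alpha D) ≤ (bigP D ^ 2) ^ (2 * alpha D) :=
        Real.rpow_le_rpow hk0.le hkP (by positivity)
    _ = Real.exp (4 * π) := by
        rw [bigP, ← Real.exp_nat_mul, ← Real.exp_mul]
        congr 1
        rw [hα]; field_simp; push_cast; ring

/-- `(log ⌊P²⌋)⁴ ≤ 16𝓛³⁶` (`log P² = 2𝓛⁹`). [cite: Zhang2022LandauSiegel, §2 (2.6)] -/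
private theorem log_floor_pow_four_le {D : ℕ} (hK : 2 ≤ ⌊bigP D ^ 2⌋₊) :
    Real.log (⌊bigP D ^ 2⌋₊ : ℝ) ^ 4 ≤ 16 * ell D ^ 36 := by
  have hK0 : (0 : ℝ) < ⌊bigP D ^ 2⌋₊ := by exact_mod_cast (by omega : 0 < ⌊bigP D ^ 2⌋₊)
  have h1 : Real.log (⌊bigP D ^ 2⌋₊ : ℝ) ≤ 2 * ell D ^ 9 := by
    calc Real.log (⌊bigP D ^ 2⌋₊ : ℝ) ≤ Real.log (bigP D ^ 2) :=
          Real.log_le_log hK0 (Nat.floor_le (by positivity))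
      _ = 2 * ell D ^ 9 := by rw [bigP, ← Real.exp_nat_mul, Real.log_exp]; push_cast; ring
  have h0 : 0 ≤ Real.log (⌊bigP D ^ 2⌋₊ : ℝ) :=
    Real.log_nonneg (by exact_mod_cast (by omega : 1 ≤ ⌊bigP D ^ 2⌋₊))
  calc Real.log (⌊bigP D ^ 2⌋₊ : ℝ) ^ 4 ≤ (2 * ell D ^ 9) ^ 4 := pow_le_pow_left₀ h0 h1 4
    _ = 16 * ell D ^ 36 := by ring

/-- `(⌈y⌉ − 1)² ≤ ⌊P²⌋` when `0 ≤ y ≤ P`. [cite: Zhang2022LandauSiegel, §7 (7.5) p.35] -/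
private theorem len_sq_le {D : ℕ} {y : ℝ} (hy0 : 0 ≤ y) (hy : y ≤ bigP D) :
    (⌈y⌉₊ - 1) * (⌈y⌉₊ - 1) ≤ ⌊bigP D ^ 2⌋₊ := by
  have h1 : ((⌈y⌉₊ - 1 : ℕ) : ℝ) ≤ y := cast_ceil_sub_one_le hy0
  have h0 : 0 ≤ ((⌈y⌉₊ - 1 : ℕ) : ℝ) := Nat.cast_nonneg _
  apply Nat.le_floor
  push_cast
  calc ((⌈y⌉₊ - 1 : ℕ) : ℝ) * ((⌈y⌉₊ - 1 : ℕ) : ℝ) ≤ y * y := mul_le_mul h1 h1 h0 hy0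
    _ ≤ bigP D * bigP D := mul_le_mul hy hy hy0 (Real.exp_pos _).le
    _ = bigP D ^ 2 := (sq _).symm

/-- **`Σ_{ψ∈T} |K(w,ψ)|⁴ ≪ P²𝓛³⁶` on `σ = 1/2 + α`** (any finite `T ⊆ Ψ`, large `D`): length
`(2P₄)² ≤ P²` (`2t₀ ≤ T²`), weight `n^{−1−2α} ≤ n⁻¹`. [cite: Zhang2022LandauSiegel, §8 p.43, tex L2244–2247] -/
private theorem fourth_moment_K : ∃ C : ℝ, ∃ D₀ : ℕ, ∀ D : ℕ, D₀ ≤ D →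
    ∀ (T : Finset (Chr D)) (w : ℂ), w.re = 1 / 2 + alpha D →
      ∑ x ∈ T, ‖Kchar D (psiFn x) w‖ ^ 4 ≤ C * bigP D ^ 2 * ell D ^ 36 := by
  obtain ⟨D₁, h₁⟩ := eventually_sizes
  obtain ⟨D₂, h₂⟩ := eventually_two_t0_le
  refine ⟨(2 + 2 * (3 + (Real.log 2 ^ 68)⁻¹) ^ 2) * (16 * majorantConst 4 4), max D₁ D₂,
    fun D hD T w hw => ?_⟩
  obtain ⟨hL3, -, -, hK2⟩ := h₁ D (le_trans (le_max_left _ _) hD)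
  have ht0T := h₂ D (le_trans (le_max_right _ _) hD)
  have hL0 : 0 < ell D := by linarith
  have hα0 : 0 ≤ alpha D := by rw [alpha, bigP, Real.log_exp]; positivity
  have ht00 : 0 < t0 D := by unfold t0; positivity
  have hT0 : 0 < bigT D := Real.exp_pos _
  have hP0 : 0 < bigP D := Real.exp_pos _
  have hP4 : 0 ≤ 2 * P4 D := by unfold P4; positivity
  have hP4' : 2 * P4 D ≤ bigP D := by
    have hT : 0 < bigT D ^ 2 := by positivity
    rw [show 2 * P4 D = bigP D * (2 * t0 D / bigT D ^ 2) by unfold P4; ring]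
    apply mul_le_of_le_one_right (Real.exp_pos _).le
    rw [div_le_one hT]; exact ht0T
  have hmain := fourth_moment_le T (len_sq_le hP4 hP4') hK2 (fun n => (gstar D (P4 D / n) : ℂ))
    (B := 1) (fun n => norm_gstar_le hL0 _) w (fun k hk => weight_half_add hα0 hw k hk)
  have hlog := log_floor_pow_four_le hK2
  have hmc := (majorantConst_pos 4 4).le
  rw [max_eq_left zero_le_one, one_pow, one_mul, one_mul] at hmain
  calc ∑ x ∈ T, ‖Kchar D (psiFn x) w‖ ^ 4
      = ∑ x ∈ T, ‖∑ n ∈ Finset.Ico 1 ⌈2 * P4 D⌉₊,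
          (gstar D (P4 D / n) : ℂ) * x.ψ (n : ZMod x.p) * (n : ℂ) ^ (-w)‖ ^ 4 := by
        simp_rw [Kchar_eq]
    _ ≤ (2 + 2 * (3 + (Real.log 2 ^ 68)⁻¹) ^ 2) * bigP D ^ 2 *
          (majorantConst 4 4 * Real.log (⌊bigP D ^ 2⌋₊ : ℝ) ^ 4) := hmain
    _ ≤ (2 + 2 * (3 + (Real.log 2 ^ 68)⁻¹) ^ 2) * bigP D ^ 2 *
          (majorantConst 4 4 * (16 * ell D ^ 36)) :=
        mul_le_mul_of_nonneg_left (mul_le_mul_of_nonneg_left hlog hmc) (by positivity)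
    _ = _ := by ring

/-- **`Σ_{ψ∈T} |N(u,ψ)|⁴ ≪ P²𝓛³⁶` on `σ = 1/2 − α`** (any finite `T ⊆ Ψ`, large `D`): length
`(2T²)² ≤ P²`, weight `n^{2α−1} ≤ e^{4π}n⁻¹`. [cite: Zhang2022LandauSiegel, §8 p.43, tex L2244–2247] -/
private theorem fourth_moment_N : ∃ C : ℝ, ∃ D₀ : ℕ, ∀ D : ℕ, D₀ ≤ D →
    ∀ (T : Finset (Chr D)) (u : ℂ), u.re = 1 / 2 - alpha D →
      ∑ x ∈ T, ‖Nchar D (psiFn x) u‖ ^ 4 ≤ C * bigP D ^ 2 * ell D ^ 36 := by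
  obtain ⟨D₁, h₁⟩ := eventually_sizes
  refine ⟨(2 + 2 * (3 + (Real.log 2 ^ 68)⁻¹) ^ 2) * (Real.exp (4 * π) * (16 * majorantConst 4 4)),
    D₁, fun D hD T u hu => ?_⟩
  obtain ⟨hL3, h2T, -, hK2⟩ := h₁ D hD
  have hL0 : 0 < ell D := by linarith
  have hT0 : 0 < bigT D := Real.exp_pos _
  have hT2 : 0 ≤ 2 * bigT D ^ 2 := by positivity
  have hmain := fourth_moment_le T (len_sq_le hT2 h2T) hK2 (fun n => (gstar D (bigT D ^ 2 / n) : ℂ))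
    (B := 1) (fun n => norm_gstar_le hL0 _) u (fun k hk => weight_half_sub hL0 hu k hk)
  have hlog := log_floor_pow_four_le hK2
  have hmc := (majorantConst_pos 4 4).le
  rw [max_eq_left zero_le_one, one_pow, one_mul] at hmain
  calc ∑ x ∈ T, ‖Nchar D (psiFn x) u‖ ^ 4
      = ∑ x ∈ T, ‖∑ n ∈ Finset.Ico 1 ⌈2 * bigT D ^ 2⌉₊,
          (gstar D (bigT D ^ 2 / n) : ℂ) * x.ψ (n : ZMod x.p) * (n : ℂ) ^ (-u)‖ ^ 4 := by
        simp_rw [Nchar_eq]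
    _ ≤ (2 + 2 * (3 + (Real.log 2 ^ 68)⁻¹) ^ 2) * bigP D ^ 2 *
          (Real.exp (4 * π) * (majorantConst 4 4 * Real.log (⌊bigP D ^ 2⌋₊ : ℝ) ^ 4)) := hmain
    _ ≤ (2 + 2 * (3 + (Real.log 2 ^ 68)⁻¹) ^ 2) * bigP D ^ 2 *
          (Real.exp (4 * π) * (majorantConst 4 4 * (16 * ell D ^ 36))) :=
        mul_le_mul_of_nonneg_left (mul_le_mul_of_nonneg_left
          (mul_le_mul_of_nonneg_left hlog hmc) (Real.exp_pos _).le) (by positivity)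
    _ = _ := by ring


/-! ## C. The error term `E₁(s,ψ)⁴`: Hölder in `v`, then the large sieve pointwise in `v` -/

/-- **Hölder**: `(∫_{−L}^{L} f)⁴ ≤ (2L)³ ∫_{−L}^{L} f⁴` for a continuous bounded `f ≥ 0`.
[cite: Zhang2022LandauSiegel, §8 p.43 ("By Cauchy's inequality")] -/
private theorem integral_pow_four_le {f : ℝ → ℝ} (hf : Continuous f) (h0 : ∀ v, 0 ≤ f v)
    {M : ℝ} (hM : ∀ v, f v ≤ M) {L : ℝ} (hL : 0 ≤ L) :
    (∫ v in (-L)..L, f v) ^ 4 ≤ (2 * L) ^ 3 * ∫ v in (-L)..L, f v ^ 4 := by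
  have hLL : -L ≤ L := by linarith
  rw [intervalIntegral.integral_of_le hLL, intervalIntegral.integral_of_le hLL]
  set μ : Measure ℝ := volume.restrict (Set.Ioc (-L) L) with hμ
  have hpq : (4 : ℝ).HolderConjugate (4 / 3) :=
    Real.holderConjugate_iff.mpr ⟨by norm_num, by norm_num⟩
  have hfm : MemLp f (ENNReal.ofReal 4) μ :=
    MemLp.of_bound hf.aestronglyMeasurable M
      (ae_of_all _ fun v => by rw [Real.norm_of_nonneg (h0 v)]; exact hM v)
  have hgm : MemLp (fun _ : ℝ => (1 : ℝ)) (ENNReal.ofReal (4 / 3)) μ := memLp_const 1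
  have hH := integral_mul_le_Lp_mul_Lq_of_nonneg hpq (ae_of_all _ h0)
    (ae_of_all _ fun _ => zero_le_one) hfm hgm
  have hμu : μ.real Set.univ = 2 * L := by
    rw [hμ, measureReal_restrict_apply_univ, Real.volume_real_Ioc_of_le hLL]; ring
  have hI0 : 0 ≤ ∫ v, f v ∂μ := integral_nonneg h0
  have hI4 : 0 ≤ ∫ v, f v ^ 4 ∂μ := integral_nonneg fun v => by positivity
  simp only [mul_one, Real.one_rpow, integral_const, smul_eq_mul, hμu, Real.rpow_ofNat] at hH
  have h2L : 0 ≤ 2 * L := by linarith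
  calc (∫ v, f v ∂μ) ^ 4
      ≤ ((∫ v, f v ^ 4 ∂μ) ^ (1 / 4 : ℝ) * (2 * L) ^ (1 / (4 / 3) : ℝ)) ^ 4 :=
        pow_le_pow_left₀ hI0 hH 4
    _ = (2 * L) ^ 3 * ∫ v, f v ^ 4 ∂μ := by
        rw [mul_pow, ← Real.rpow_natCast ((∫ v, f v ^ 4 ∂μ) ^ (1 / 4 : ℝ)) 4,
          ← Real.rpow_mul hI4, ← Real.rpow_natCast ((2 * L) ^ (1 / (4 / 3) : ℝ)) 4,
          ← Real.rpow_mul h2L]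
        norm_num
        ring

/-- The integrand `v ↦ |Σ_{n<T³} ψ(n)n^{−(w+iv)}|·ω₁(iv)` of `E₁(w,ψ)` is continuous.
[cite: Zhang2022LandauSiegel, §6 Lemma 6.1 p.30] -/
private theorem continuous_E1integrand {D : ℕ} (x : Chr D) (w : ℂ) :
    Continuous fun v : ℝ =>
      ‖∑ n ∈ Finset.Ico 1 ⌈bigT D ^ 3⌉₊, x.ψ (n : ZMod x.p) * (n : ℂ) ^ (-(w + v * I))‖ *
        Real.exp (-(v ^ 2) / (4 * ell D ^ 30)) := by
  refine (Continuous.norm ?_).mul (by fun_prop)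
  refine continuous_finsetSum _ fun n hn => ?_
  have hn0 : (n : ℂ) ≠ 0 := by
    exact_mod_cast (Nat.one_le_iff_ne_zero.mp (Finset.mem_Ico.mp hn).1)
  exact continuous_const.mul
    ((continuous_const.add (Complex.continuous_ofReal.mul continuous_const)).neg.const_cpow
      (Or.inl hn0))

/-- A trivial bound for the integrand of `E₁`: `|Σ_{n<T³} ψ(n)n^{−(w+iv)}|·ω₁ ≤ #{n < T³}` for
`Re w ≥ 0`. [cite: Zhang2022LandauSiegel, §6 Lemma 6.1 p.30] -/
private theorem E1integrand_le {D : ℕ} (x : Chr D) {w : ℂ} (hw : 0 ≤ w.re) (v : ℝ) :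
    ‖∑ n ∈ Finset.Ico 1 ⌈bigT D ^ 3⌉₊, x.ψ (n : ZMod x.p) * (n : ℂ) ^ (-(w + v * I))‖ *
        Real.exp (-(v ^ 2) / (4 * ell D ^ 30)) ≤ ((Finset.Ico 1 ⌈bigT D ^ 3⌉₊).card : ℝ) := by
  have hexp : Real.exp (-(v ^ 2) / (4 * ell D ^ 30)) ≤ 1 := by
    rw [Real.exp_le_one_iff, neg_div]
    exact neg_nonpos.mpr (by positivity)
  have hsum : ‖∑ n ∈ Finset.Ico 1 ⌈bigT D ^ 3⌉₊, x.ψ (n : ZMod x.p) * (n : ℂ) ^ (-(w + v * I))‖ ≤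
      ((Finset.Ico 1 ⌈bigT D ^ 3⌉₊).card : ℝ) := by
    have h : ∀ n ∈ Finset.Ico 1 ⌈bigT D ^ 3⌉₊,
        ‖x.ψ (n : ZMod x.p) * (n : ℂ) ^ (-(w + v * I))‖ ≤ 1 := by
      intro n hn
      have hn1 : 1 ≤ n := (Finset.mem_Ico.mp hn).1
      rw [norm_mul, Complex.norm_natCast_cpow_of_pos hn1]
      have h1 : ‖x.ψ (n : ZMod x.p)‖ ≤ 1 := x.ψ.norm_le_one _
      have h2 : (n : ℝ) ^ ((-(w + v * I)).re) ≤ 1 :=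
        Real.rpow_le_one_of_one_le_of_nonpos (by exact_mod_cast hn1) (by simp; linarith)
      calc ‖x.ψ (n : ZMod x.p)‖ * (n : ℝ) ^ ((-(w + v * I)).re) ≤ 1 * 1 :=
            mul_le_mul h1 h2 (Real.rpow_nonneg (Nat.cast_nonneg n) _) zero_le_one
        _ = 1 := one_mul 1
    calc _ ≤ ∑ n ∈ Finset.Ico 1 ⌈bigT D ^ 3⌉₊, ‖x.ψ (n : ZMod x.p) * (n : ℂ) ^ (-(w + v * I))‖ :=
          norm_sum_le _ _
      _ ≤ ∑ n ∈ Finset.Ico 1 ⌈bigT D ^ 3⌉₊, (1 : ℝ) := Finset.sum_le_sum h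
      _ = _ := by simp
  calc _ ≤ ((Finset.Ico 1 ⌈bigT D ^ 3⌉₊).card : ℝ) * 1 :=
        mul_le_mul hsum hexp (Real.exp_pos _).le (Nat.cast_nonneg _)
    _ = _ := mul_one _

/-- **`Σ_{ψ∈T} E₁(w,ψ)⁴ ≪ P²𝓛³⁶` on `σ = 1/2 + α`** (the main part of `E₁`, any finite `T ⊆ Ψ`, large
`D`): Hölder in `v` (`(∫_{−𝓛²⁰}^{𝓛²⁰} f)⁴ ≤ (2𝓛²⁰)³∫f⁴`), the sum over `ψ` taken inside the integral,
and the large sieve pointwise in `v` (length `(T³)² ≤ P²`, weight `n^{−1−2α} ≤ n⁻¹`, `ω₁ ≤ 1`); the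
prefactor `𝓛⁻²⁷²(2𝓛²⁰)⁴ ≤ 16`. [cite: Zhang2022LandauSiegel, §8 p.43, tex L2244–2247; §6 Lemma 6.1 p.30] -/
private theorem fourth_moment_E : ∃ C : ℝ, ∃ D₀ : ℕ, ∀ D : ℕ, D₀ ≤ D →
    ∀ (T : Finset (Chr D)) (w : ℂ), w.re = 1 / 2 + alpha D →
      ∑ x ∈ T, E1main x w ^ 4 ≤ C * bigP D ^ 2 * ell D ^ 36 := by
  obtain ⟨D₁, h₁⟩ := eventually_sizes
  refine ⟨(2 + 2 * (3 + (Real.log 2 ^ 68)⁻¹) ^ 2) * (256 * majorantConst 4 4), D₁,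
    fun D hD T w hw => ?_⟩
  obtain ⟨hL3, -, hT3, hK2⟩ := h₁ D hD
  have hL0 : 0 < ell D := by linarith
  have hL1 : 1 ≤ ell D := by linarith
  have hα0 : 0 ≤ alpha D := by rw [alpha, bigP, Real.log_exp]; positivity
  have hw0 : 0 ≤ w.re := by rw [hw]; positivity
  have hT0 : 0 ≤ bigT D ^ 3 := by unfold bigT; positivity
  set L : ℝ := ell D ^ 20 with hLdef
  have hL20 : 0 ≤ L := by positivity
  set Nn := ⌈bigT D ^ 3⌉₊ with hNn
  set B : ℝ := (2 + 2 * (3 + (Real.log 2 ^ 68)⁻¹) ^ 2) * bigP D ^ 2 *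
    (majorantConst 4 4 * Real.log (⌊bigP D ^ 2⌋₊ : ℝ) ^ 4) with hBdef
  -- the integrand of `E₁(w,ψ)`
  set f : Chr D → ℝ → ℝ := fun x v =>
    ‖∑ n ∈ Finset.Ico 1 Nn, x.ψ (n : ZMod x.p) * (n : ℂ) ^ (-(w + v * I))‖ *
      Real.exp (-(v ^ 2) / (4 * ell D ^ 30)) with hfdef
  have hfc : ∀ x, Continuous (f x) := fun x => continuous_E1integrand x w
  have hf0 : ∀ x v, 0 ≤ f x v := fun x v => by positivity
  have hfM : ∀ x v, f x v ≤ ((Finset.Ico 1 Nn).card : ℝ) := fun x v => E1integrand_le x hw0 v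
  -- the large sieve, pointwise in `v`
  have hB : ∀ v : ℝ, ∑ x ∈ T, f x v ^ 4 ≤ B := by
    intro v
    have hre : (w + v * I).re = 1 / 2 + alpha D := by simp [hw]
    have hmain := fourth_moment_le T (len_sq_le hT0 hT3) hK2 (fun _ => (1 : ℂ)) (B := 1)
      (fun n => by simp) (w + v * I) (fun k hk => weight_half_add hα0 hre k hk)
    simp only [one_mul, max_eq_left (zero_le_one (α := ℝ)), one_pow] at hmain
    refine le_trans (Finset.sum_le_sum fun x _ => ?_) hmain
    have hexp : Real.exp (-(v ^ 2) / (4 * ell D ^ 30)) ≤ 1 := by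
      rw [Real.exp_le_one_iff, neg_div]
      exact neg_nonpos.mpr (by positivity)
    have hS := norm_nonneg (∑ n ∈ Finset.Ico 1 Nn, x.ψ (n : ZMod x.p) * (n : ℂ) ^ (-(w + v * I)))
    calc f x v ^ 4 ≤ (‖∑ n ∈ Finset.Ico 1 Nn, x.ψ (n : ZMod x.p) * (n : ℂ) ^ (-(w + v * I))‖ * 1) ^ 4 := by
          apply pow_le_pow_left₀ (hf0 x v)
          exact mul_le_mul_of_nonneg_left hexp hS
      _ = _ := by rw [mul_one]
  -- Hölder, per `ψ`
  have hH : ∀ x ∈ T, E1main x w ^ 4 ≤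
      (ell D ^ 68)⁻¹ ^ 4 * ((2 * L) ^ 3 * ∫ v in (-L)..L, f x v ^ 4) := by
    intro x _
    have hE : E1main x w = (ell D ^ 68)⁻¹ * ∫ v in (-L)..L, f x v := rfl
    rw [hE, mul_pow]
    exact mul_le_mul_of_nonneg_left (integral_pow_four_le (hfc x) (hf0 x) (hfM x) hL20)
      (by positivity)
  -- interval integrability of the fourth powers and their sum
  have hfi : ∀ x ∈ T, IntervalIntegrable (fun v => f x v ^ 4) volume (-L) L :=
    fun x _ => ((hfc x).pow 4).intervalIntegrable _ _
  have hLL : -L ≤ L := by linarith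
  calc ∑ x ∈ T, E1main x w ^ 4
      ≤ ∑ x ∈ T, (ell D ^ 68)⁻¹ ^ 4 * ((2 * L) ^ 3 * ∫ v in (-L)..L, f x v ^ 4) :=
        Finset.sum_le_sum hH
    _ = (ell D ^ 68)⁻¹ ^ 4 * ((2 * L) ^ 3 * ∫ v in (-L)..L, ∑ x ∈ T, f x v ^ 4) := by
        rw [intervalIntegral.integral_finsetSum hfi, Finset.mul_sum, Finset.mul_sum]
    _ ≤ (ell D ^ 68)⁻¹ ^ 4 * ((2 * L) ^ 3 * ∫ _ in (-L)..L, B) := by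
        apply mul_le_mul_of_nonneg_left _ (by positivity)
        apply mul_le_mul_of_nonneg_left _ (by positivity)
        exact intervalIntegral.integral_mono_on hLL
          ((continuous_finsetSum T fun x _ => (hfc x).pow 4).intervalIntegrable _ _)
          intervalIntegrable_const (fun v _ => hB v)
    _ = (ell D ^ 68)⁻¹ ^ 4 * (2 * L) ^ 4 * B := by
        rw [intervalIntegral.integral_const, smul_eq_mul]; ring
    _ ≤ 16 * B := by
        have hB0 : 0 ≤ B := by
          rw [hBdef]
          have := (majorantConst_pos 4 4).le
          have hlog : 0 ≤ Real.log (⌊bigP D ^ 2⌋₊ : ℝ) :=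
            Real.log_nonneg (by exact_mod_cast (by omega : 1 ≤ ⌊bigP D ^ 2⌋₊))
          positivity
        apply mul_le_mul_of_nonneg_right _ hB0
        have hℓ : ell D ≠ 0 := hL0.ne'
        have h1 : (ell D ^ 68)⁻¹ ^ 4 * (2 * L) ^ 4 = 16 * (ell D ^ 192)⁻¹ := by
          rw [hLdef]; field_simp; ring
        rw [h1]
        have h2 : (ell D ^ 192)⁻¹ ≤ 1 := inv_le_one_of_one_le₀ (one_le_pow₀ hL1)
        linarith
    _ ≤ _ := by
        rw [hBdef]
        have hlog := log_floor_pow_four_le hK2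
        have hmc := (majorantConst_pos 4 4).le
        calc 16 * ((2 + 2 * (3 + (Real.log 2 ^ 68)⁻¹) ^ 2) * bigP D ^ 2 *
              (majorantConst 4 4 * Real.log (⌊bigP D ^ 2⌋₊ : ℝ) ^ 4))
            ≤ 16 * ((2 + 2 * (3 + (Real.log 2 ^ 68)⁻¹) ^ 2) * bigP D ^ 2 *
              (majorantConst 4 4 * (16 * ell D ^ 36))) := by
              apply mul_le_mul_of_nonneg_left _ (by norm_num)
              exact mul_le_mul_of_nonneg_left (mul_le_mul_of_nonneg_left hlog hmc) (by positivity)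
          _ = _ := by ring


/-! ## D. `|Z(w,ψ)| ≪ 1` on the range of Lemma 6.1 (the Stirling bound of the tree) -/

/-- `2α = 2π𝓛⁻⁹ ≤ 1/4` for `𝓛 ≥ 3`. [cite: Zhang2022LandauSiegel, §2 (2.10)] -/
private theorem two_alpha_le {D : ℕ} (hL : 3 ≤ ell D) : 2 * alpha D ≤ 1 / 4 := by
  have hα : alpha D = π / ell D ^ 9 := by rw [alpha, bigP, Real.log_exp]
  have hL9 : (3 : ℝ) ^ 9 ≤ ell D ^ 9 := pow_le_pow_left₀ (by norm_num) hL 9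
  rw [hα, mul_div_assoc', div_le_iff₀ (by positivity)]
  nlinarith [Real.pi_lt_four]

/-- The window `p ∼ P`: `P < p < P(1 + 𝓛⁻⁶⁸)`. [cite: Zhang2022LandauSiegel, §2 p. 4] -/
private theorem window {D : ℕ} (x : Chr D) :
    bigP D < x.p ∧ (x.p : ℝ) < bigP D * (1 + (ell D ^ 68)⁻¹) := by
  have hm := x.mem
  rw [primeWindow, Finset.mem_filter, Finset.mem_Ioo] at hm
  have hP : 0 ≤ bigP D := (Real.exp_pos _).le
  exact ⟨(Nat.floor_lt hP).mp hm.1.1, Nat.lt_ceil.mp hm.1.2⟩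

/-- The `t`-range `|t − 2πt₀| < 𝓛₁ + 2` gives `5𝓛⁵¹⁹ ≤ t ≤ 8𝓛⁵¹⁹` (`𝓛 ≥ 3`).
[cite: Zhang2022LandauSiegel, §2 (2.8)] -/
private theorem t_range {L t : ℝ} (hL : 3 ≤ L) (ht : |t - 2 * π * L ^ 519| < L ^ 405 + 2) :
    5 * L ^ 519 ≤ t ∧ t ≤ 8 * L ^ 519 := by
  have hL1 : 1 ≤ L := by linarith
  have h405 : L ^ 405 + 2 ≤ L ^ 519 := by
    have h1 : (1 : ℝ) ≤ L ^ 405 := one_le_pow₀ hL1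
    have h114 : (9 : ℝ) ≤ L ^ 114 := by
      have h : L ^ 2 ≤ L ^ 114 := pow_le_pow_right₀ hL1 (by norm_num)
      nlinarith
    calc L ^ 405 + 2 ≤ L ^ 405 * 9 := by nlinarith
      _ ≤ L ^ 405 * L ^ 114 := by gcongr
      _ = L ^ 519 := by rw [← pow_add]
  obtain ⟨ht1, ht2⟩ := abs_lt.mp ht
  have hπa : 3 * L ^ 519 ≤ π * L ^ 519 :=
    mul_le_mul_of_nonneg_right Real.pi_gt_three.le (by positivity)
  have hπb : π * L ^ 519 ≤ 3.15 * L ^ 519 :=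
    mul_le_mul_of_nonneg_right Real.pi_lt_d2.le (by positivity)
  exact ⟨by linarith, by linarith⟩

/-- `|log(kt/2π)| ≤ 2𝓛⁹` for `1 ≤ k`, `log k ≤ 𝓛⁹ + 𝓛 + 1`, `5𝓛⁵¹⁹ ≤ t ≤ 8𝓛⁵¹⁹` (`𝓛 ≥ 3`).
[cite: Zhang2022LandauSiegel, §5 Lemma 5.1 (proof)] -/
private theorem abs_log_kt_le {L t K : ℝ} (hL : 3 ≤ L) (ht5 : 5 * L ^ 519 ≤ t)
    (ht8 : t ≤ 8 * L ^ 519) (hK1 : 1 ≤ K) (hK : Real.log K ≤ L ^ 9 + L + 1) :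
    |Real.log (K * t / (2 * π))| ≤ 2 * L ^ 9 := by
  have hL1 : 1 ≤ L := by linarith
  have hL0 : 0 < L := by linarith
  have hK0 : 0 < K := by linarith
  have h519 : (1 : ℝ) ≤ L ^ 519 := one_le_pow₀ hL1
  have h519' : (3 : ℝ) ≤ L ^ 519 := hL.trans (le_self_pow₀ hL1 (by norm_num))
  have ht0 : 0 < t := by linarith
  have hy1 : 1 ≤ K * t / (2 * π) := by
    rw [le_div_iff₀ (by positivity), one_mul]
    have hKt : t ≤ K * t := le_mul_of_one_le_left ht0.le hK1
    linarith [Real.pi_lt_four]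
  rw [abs_of_nonneg (Real.log_nonneg hy1), mul_div_assoc, Real.log_mul hK0.ne' (by positivity)]
  have hlogt : Real.log (t / (2 * π)) ≤ 3 + 519 * L := by
    have h1 : t / (2 * π) ≤ 8 * L ^ 519 := by
      rw [div_le_iff₀ (by positivity)]; nlinarith [Real.pi_gt_three, pow_pos hL0 519]
    have h2 : 0 < t / (2 * π) := by positivity
    calc Real.log (t / (2 * π)) ≤ Real.log (8 * L ^ 519) := Real.log_le_log h2 h1
      _ = Real.log 8 + 519 * Real.log L := by
          rw [Real.log_mul (by norm_num) (by positivity), Real.log_pow]; push_cast; ring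
      _ ≤ 3 + 519 * L := by
          have h8 : Real.log 8 ≤ 3 := by
            rw [show (8 : ℝ) = 2 ^ 3 by norm_num, Real.log_pow]; push_cast
            linarith [Real.log_two_lt_d9]
          have hLL : Real.log L ≤ L := (Real.log_le_sub_one_of_pos hL0).trans (by linarith)
          linarith
  have h9 : 520 * L + 4 ≤ L ^ 9 := by
    have h1 : L ^ 9 = L * L ^ 8 := by ring
    have h8 : (3 : ℝ) ^ 8 ≤ L ^ 8 := pow_le_pow_left₀ (by norm_num) hL 8
    nlinarith
  linarith

/-- **The implicit input `|Z(w,ψ)| ≪ 1` of §8.u013**: for `𝓛 ≥ 3`, `ψ ∈ Ψ` and `w` in the range of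
Lemma 6.1 (`|Re w − 1/2| < 2α`, `|Im w − 2πt₀| < 𝓛₁ + 2`), `|Z(w,ψ)| ≤ e¹³` — from the tree's
`GammaFactor.norm_Zfac_le_exp_of_abs_sub_half_le` (`|Z(σ+it,θ)| ≤ exp(|σ − 1/2|(|log(kt/2π)| + 14/t))`,
Stirling) with `|σ − 1/2| < 2π𝓛⁻⁹`, `|log(pt/2π)| ≤ 2𝓛⁹`.
[cite: Zhang2022LandauSiegel, §6 Lemma 6.1 p.30; §5 Lemma 5.1 (proof)] -/
private theorem norm_Zfac_le_exp13 {D : ℕ} (hL3 : 3 ≤ ell D) (x : Chr D) {w : ℂ}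
    (hσ : |w.re - 1 / 2| < 2 * alpha D) (htr : |w.im - 2 * π * t0 D| < ell1 D + 2) :
    ‖GammaFactor.Zfac x.ψ w‖ ≤ Real.exp 13 := by
  have hL0 : 0 < ell D := by linarith
  have hL1 : 1 ≤ ell D := by linarith
  obtain ⟨σ, t, rfl⟩ : ∃ σ' t' : ℝ, w = σ' + t' * I := ⟨w.re, w.im, (re_add_im w).symm⟩
  have hσ' : |σ - 1 / 2| < 2 * alpha D := by simpa using hσ
  have htr' : |t - 2 * π * ell D ^ 519| < ell D ^ 405 + 2 := by
    have h := htr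
    rw [ell1, t0] at h
    simpa using h
  have hα : alpha D = π / ell D ^ 9 := by rw [alpha, bigP, Real.log_exp]
  obtain ⟨ht5, ht8⟩ := t_range hL3 htr'
  have h519 : (1 : ℝ) ≤ ell D ^ 519 := one_le_pow₀ hL1
  have ht4 : 4 ≤ t := by linarith
  have ht0 : 0 < t := by linarith
  have h9pos : 0 < ell D ^ 9 := by positivity
  have hσ4 : |σ - 1 / 2| ≤ 1 / 4 := hσ'.le.trans (two_alpha_le hL3)
  obtain ⟨hPp, hpP⟩ := window x
  have hP0 : 0 < bigP D := Real.exp_pos _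
  have hlogP : Real.log (bigP D) = ell D ^ 9 := by rw [bigP, Real.log_exp]
  have hp0 : (0 : ℝ) < x.p := hP0.trans hPp
  have hp1 : (1 : ℝ) ≤ x.p := by exact_mod_cast x.prime.one_lt.le
  have hlogp : Real.log (x.p : ℝ) ≤ ell D ^ 9 + ell D + 1 := by
    have h68 : (ell D ^ 68)⁻¹ ≤ 1 := inv_le_one_of_one_le₀ (one_le_pow₀ hL1)
    have h4 : (x.p : ℝ) ≤ bigP D * 2 :=
      hpP.le.trans (mul_le_mul_of_nonneg_left (by linarith) hP0.le)
    calc Real.log (x.p : ℝ) ≤ Real.log (bigP D * 2) := Real.log_le_log hp0 h4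
      _ = ell D ^ 9 + Real.log 2 := by rw [Real.log_mul hP0.ne' two_ne_zero, hlogP]
      _ ≤ ell D ^ 9 + ell D + 1 := by linarith [Real.log_two_lt_d9]
  have hlog : |Real.log ((x.p : ℝ) * t / (2 * π))| ≤ 2 * ell D ^ 9 :=
    abs_log_kt_le hL3 ht5 ht8 hp1 hlogp
  have h14 : 14 / t ≤ 4 := by rw [div_le_iff₀ ht0]; linarith
  refine (GammaFactor.norm_Zfac_le_exp_of_abs_sub_half_le x.prim hσ4 ht4).trans
    (Real.exp_le_exp.mpr ?_)
  have ha : |σ - 1 / 2| ≤ 2 * π / ell D ^ 9 := by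
    rw [hα, ← mul_div_assoc] at hσ'
    exact hσ'.le
  calc |σ - 1 / 2| * (|Real.log ((x.p : ℝ) * t / (2 * π))| + 14 / t)
      ≤ (2 * π / ell D ^ 9) * (2 * ell D ^ 9 + 4) :=
        mul_le_mul ha (by linarith) (by positivity) (by positivity)
    _ = 4 * π + 8 * π / ell D ^ 9 := by field_simp; ring
    _ ≤ 13 := by
        have h : 8 * π / ell D ^ 9 ≤ 1 / 100 := by
          rw [div_le_iff₀ h9pos]
          have hL9 : (3 : ℝ) ^ 9 ≤ ell D ^ 9 := pow_le_pow_left₀ (by norm_num) hL3 9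
          nlinarith [Real.pi_lt_four]
        linarith [Real.pi_lt_d2]

/-! ## E. Assembly: the fourth moment of `L(w,ψ)` over `Ψ₁`, and `Z22:§8.u013` -/

/-- `(a+b+c+d)⁴ ≤ 64(a⁴+b⁴+c⁴+d⁴)` (Cauchy's inequality twice). [folklore] -/
private theorem add_pow_four_le (a b c d : ℝ) :
    (a + b + c + d) ^ 4 ≤ 64 * (a ^ 4 + b ^ 4 + c ^ 4 + d ^ 4) := by
  have h1 : (a + b + c + d) ^ 2 ≤ 4 * (a ^ 2 + b ^ 2 + c ^ 2 + d ^ 2) := by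
    nlinarith [sq_nonneg (a - b), sq_nonneg (a - c), sq_nonneg (a - d), sq_nonneg (b - c),
      sq_nonneg (b - d), sq_nonneg (c - d)]
  have h2 : (a ^ 2 + b ^ 2 + c ^ 2 + d ^ 2) ^ 2 ≤ 4 * (a ^ 4 + b ^ 4 + c ^ 4 + d ^ 4) := by
    nlinarith [sq_nonneg (a ^ 2 - b ^ 2), sq_nonneg (a ^ 2 - c ^ 2), sq_nonneg (a ^ 2 - d ^ 2),
      sq_nonneg (b ^ 2 - c ^ 2), sq_nonneg (b ^ 2 - d ^ 2), sq_nonneg (c ^ 2 - d ^ 2)]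
  calc (a + b + c + d) ^ 4 = ((a + b + c + d) ^ 2) ^ 2 := by ring
    _ ≤ (4 * (a ^ 2 + b ^ 2 + c ^ 2 + d ^ 2)) ^ 2 := pow_le_pow_left₀ (sq_nonneg _) h1 2
    _ = 16 * (a ^ 2 + b ^ 2 + c ^ 2 + d ^ 2) ^ 2 := by ring
    _ ≤ 16 * (4 * (a ^ 4 + b ^ 4 + c ^ 4 + d ^ 4)) := by linarith
    _ = _ := by ring

/-- `E₁(w,ψ) ≥ 0` (an integral of a nonnegative function). [cite: Zhang2022LandauSiegel, §6 Lemma 6.1 p.30] -/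
private theorem E1main_nonneg {D : ℕ} (x : Chr D) (w : ℂ) : 0 ≤ E1main x w := by
  unfold E1main
  refine mul_nonneg (by positivity) (intervalIntegral.integral_nonneg ?_ fun v _ => by positivity)
  have : 0 ≤ ell D ^ 20 := by positivity
  linarith

/-- `𝔓 ≤ 4P²` for large `D` ((2.9): `𝔓 = (1 + O(𝓛⁻⁶⁸))P²𝓛⁻⁷⁷`, the tree's `frakP_bounds`).
[cite: Zhang2022LandauSiegel, §2 (2.9) p.4] -/
private theorem eventually_frakP_le : ∃ D₀ : ℕ, ∀ D : ℕ, D₀ ≤ D → frakP D ≤ 4 * bigP D ^ 2 := by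
  obtain ⟨D₀, h⟩ := frakP_bounds
  obtain ⟨D₁, h₁⟩ := eventually_sizes
  refine ⟨max D₀ D₁, fun D hD => ?_⟩
  have hb := h D (le_trans (le_max_left _ _) hD)
  obtain ⟨hL3, -, -, -⟩ := h₁ D (le_trans (le_max_right _ _) hD)
  have hL1 : 1 ≤ ell D := by linarith
  change |frakP D - bigP D ^ 2 * (ell D ^ 77)⁻¹| ≤ 3 * (ell D ^ 68)⁻¹ * (bigP D ^ 2 * (ell D ^ 77)⁻¹)
    at hb
  have hM : bigP D ^ 2 * (ell D ^ 77)⁻¹ ≤ bigP D ^ 2 :=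
    mul_le_of_le_one_right (by positivity) (inv_le_one_of_one_le₀ (one_le_pow₀ hL1))
  have hM0 : 0 ≤ bigP D ^ 2 * (ell D ^ 77)⁻¹ := by positivity
  have h68 : (ell D ^ 68)⁻¹ ≤ 1 := inv_le_one_of_one_le₀ (one_le_pow₀ hL1)
  have h3 : 3 * (ell D ^ 68)⁻¹ * (bigP D ^ 2 * (ell D ^ 77)⁻¹) ≤ 3 * (bigP D ^ 2 * (ell D ^ 77)⁻¹) := by
    nlinarith
  have := (abs_le.mp hb).2
  linarith

/-- **`Σ_{ψ∈Ψ₁} |L(w,ψ)|⁴ ≪ P²𝓛³⁶`** for `Re w = 1/2 + α`, `|Im w − 2πt₀| < 𝓛₁ + 2`, all large `D` and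
real primitive `χ (mod D)` satisfying (A), GIVEN Lemma 6.1 in its print-faithful (A)-form
`Skeleton.Lemma61A`: `|L| ≤ |K| + |Z||N| + C(E₁ + ε)` (Lemma 6.1, `|Z| ≤ e¹³`),
`(a+b+c+d)⁴ ≤ 64Σa⁴`, the three fourth moments (`fourth_moment_K/N/E`), and `#Ψ₁ ≤ 𝔓 ≤ 4P²`
(`cardPsiOneLe_holds`) for the `ε`-term. [cite: Zhang2022LandauSiegel, §8 p.43, tex L2244–2247] -/
private theorem fourth_moment_L (h61 : Skeleton.Lemma61A) : ∃ C : ℝ, ∃ D₀ : ℕ,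
    ∀ (D : ℕ) [NeZero D] (χ : DirichletCharacter ℂ D), D₀ ≤ D → χ.IsQuadratic → χ.IsPrimitive →
      AssumptionA D χ → ∀ w : ℂ, w.re = 1 / 2 + alpha D → |w.im - 2 * π * t0 D| < ell1 D + 2 →
        ∑ x ∈ finsetOf (PsiOne χ), ‖x.ψ.LFunction w‖ ^ 4 ≤ C * bigP D ^ 2 * ell D ^ 36 := by
  obtain ⟨c, hc, C61, D61, h61'⟩ := h61
  obtain ⟨CK, DK, hK⟩ := fourth_moment_K
  obtain ⟨CN, DN, hN⟩ := fourth_moment_N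
  obtain ⟨CE, DE, hE⟩ := fourth_moment_E
  obtain ⟨D₁, h₁⟩ := eventually_sizes
  obtain ⟨DP, hP⟩ := eventually_frakP_le
  set C' : ℝ := max C61 0 with hC'
  refine ⟨64 * (CK + Real.exp 13 ^ 4 * CN + C' ^ 4 * CE + C' ^ 4 * 4),
    max (max (max D61 DK) (max DN DE)) (max D₁ DP), fun D _ χ hD hq hp hA w hw him => ?_⟩
  have hD61 : D61 ≤ D := le_trans (le_trans (le_trans (le_max_left _ _) (le_max_left _ _)) (le_max_left _ _)) hD
  have hDK : DK ≤ D := le_trans (le_trans (le_trans (le_max_right _ _) (le_max_left _ _)) (le_max_left _ _)) hD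
  have hDN : DN ≤ D := le_trans (le_trans (le_trans (le_max_left _ _) (le_max_right _ _)) (le_max_left _ _)) hD
  have hDE : DE ≤ D := le_trans (le_trans (le_trans (le_max_right _ _) (le_max_right _ _)) (le_max_left _ _)) hD
  have hD₁ : D₁ ≤ D := le_trans (le_trans (le_max_left _ _) (le_max_right _ _)) hD
  have hDP : DP ≤ D := le_trans (le_trans (le_max_right _ _) (le_max_right _ _)) hD
  obtain ⟨hL3, -, -, -⟩ := h₁ D hD₁
  have hL1 : 1 ≤ ell D := by linarith
  have hαpos : 0 < alpha D := by rw [alpha, bigP, Real.log_exp]; positivity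
  have hσ : |w.re - 1 / 2| < 2 * alpha D := by
    rw [hw, show 1 / 2 + alpha D - 1 / 2 = alpha D by ring, abs_of_pos hαpos]; linarith
  have hu : (conj (1 - w)).re = 1 / 2 - alpha D := by simp [hw]; ring
  set T := finsetOf (PsiOne χ) with hT
  set ε : ℝ := Real.exp (-c * ell D ^ 10) with hε
  have hε0 : 0 ≤ ε := (Real.exp_pos _).le
  have hC'0 : 0 ≤ C' := le_max_right _ _
  -- Lemma 6.1, per `ψ`
  have hLψ : ∀ x : Chr D, ‖x.ψ.LFunction w‖ ≤ ‖Kchar D (psiFn x) w‖ +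
      Real.exp 13 * ‖Nchar D (psiFn x) (conj (1 - w))‖ + C' * E1main x w + C' * ε := by
    intro x
    have h := h61' D χ hD61 hq hp hA x w hσ him
    have hZ := norm_Zfac_le_exp13 hL3 x hσ him
    have hE0 := E1main_nonneg x w
    have hR : ‖x.ψ.LFunction w - Kchar D (psiFn x) w -
        GammaFactor.Zfac x.ψ w * Nchar D (psiBarFn x) (1 - w)‖ ≤ C' * (E1main x w + ε) :=
      h.trans (mul_le_mul_of_nonneg_right (le_max_left _ _) (by positivity))
    have hZN : ‖GammaFactor.Zfac x.ψ w * Nchar D (psiBarFn x) (1 - w)‖ ≤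
        Real.exp 13 * ‖Nchar D (psiFn x) (conj (1 - w))‖ := by
      rw [norm_mul, norm_Nchar_bar]
      exact mul_le_mul_of_nonneg_right hZ (norm_nonneg _)
    calc ‖x.ψ.LFunction w‖
        = ‖(x.ψ.LFunction w - Kchar D (psiFn x) w -
              GammaFactor.Zfac x.ψ w * Nchar D (psiBarFn x) (1 - w)) +
            Kchar D (psiFn x) w + GammaFactor.Zfac x.ψ w * Nchar D (psiBarFn x) (1 - w)‖ := by
          congr 1; ring
      _ ≤ ‖x.ψ.LFunction w - Kchar D (psiFn x) w -
              GammaFactor.Zfac x.ψ w * Nchar D (psiBarFn x) (1 - w)‖ +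
            ‖Kchar D (psiFn x) w‖ + ‖GammaFactor.Zfac x.ψ w * Nchar D (psiBarFn x) (1 - w)‖ :=
          norm_add₃_le
      _ ≤ C' * (E1main x w + ε) + ‖Kchar D (psiFn x) w‖ +
            Real.exp 13 * ‖Nchar D (psiFn x) (conj (1 - w))‖ := by linarith
      _ = _ := by ring
  -- fourth powers, per `ψ`
  have hL4 : ∀ x : Chr D, ‖x.ψ.LFunction w‖ ^ 4 ≤ 64 * (‖Kchar D (psiFn x) w‖ ^ 4 +
      Real.exp 13 ^ 4 * ‖Nchar D (psiFn x) (conj (1 - w))‖ ^ 4 + C' ^ 4 * E1main x w ^ 4 +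
        C' ^ 4 * ε ^ 4) := by
    intro x
    calc ‖x.ψ.LFunction w‖ ^ 4 ≤ (‖Kchar D (psiFn x) w‖ +
          Real.exp 13 * ‖Nchar D (psiFn x) (conj (1 - w))‖ + C' * E1main x w + C' * ε) ^ 4 :=
          pow_le_pow_left₀ (norm_nonneg _) (hLψ x) 4
      _ ≤ 64 * (‖Kchar D (psiFn x) w‖ ^ 4 + (Real.exp 13 * ‖Nchar D (psiFn x) (conj (1 - w))‖) ^ 4 +
            (C' * E1main x w) ^ 4 + (C' * ε) ^ 4) := add_pow_four_le _ _ _ _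
      _ = _ := by ring
  -- the four sums
  have hSK := hK D hDK T w hw
  have hSN := hN D hDN T (conj (1 - w)) hu
  have hSE := hE D hDE T w hw
  have hcard : (T.card : ℝ) ≤ 4 * bigP D ^ 2 := (cardPsiOneLe_holds D χ).trans (hP D hDP)
  have hε1 : ε ^ 4 ≤ 1 := by
    apply pow_le_one₀ hε0
    rw [hε, Real.exp_le_one_iff, neg_mul]
    exact neg_nonpos.mpr (by positivity)
  have hX : bigP D ^ 2 ≤ bigP D ^ 2 * ell D ^ 36 :=
    le_mul_of_one_le_right (by positivity) (one_le_pow₀ hL1)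
  have hlast : ∑ x ∈ T, C' ^ 4 * ε ^ 4 ≤ C' ^ 4 * 4 * (bigP D ^ 2 * ell D ^ 36) := by
    rw [Finset.sum_const, nsmul_eq_mul]
    have h1 : (T.card : ℝ) * (C' ^ 4 * ε ^ 4) ≤ (4 * bigP D ^ 2) * (C' ^ 4 * 1) :=
      mul_le_mul hcard (mul_le_mul_of_nonneg_left hε1 (by positivity)) (by positivity) (by positivity)
    have h2 : 0 ≤ C' ^ 4 := by positivity
    nlinarith
  calc ∑ x ∈ T, ‖x.ψ.LFunction w‖ ^ 4
      ≤ ∑ x ∈ T, 64 * (‖Kchar D (psiFn x) w‖ ^ 4 +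
          Real.exp 13 ^ 4 * ‖Nchar D (psiFn x) (conj (1 - w))‖ ^ 4 + C' ^ 4 * E1main x w ^ 4 +
            C' ^ 4 * ε ^ 4) := Finset.sum_le_sum fun x _ => hL4 x
    _ = 64 * (∑ x ∈ T, ‖Kchar D (psiFn x) w‖ ^ 4 +
          Real.exp 13 ^ 4 * ∑ x ∈ T, ‖Nchar D (psiFn x) (conj (1 - w))‖ ^ 4 +
          C' ^ 4 * ∑ x ∈ T, E1main x w ^ 4 + ∑ x ∈ T, C' ^ 4 * ε ^ 4) := by
        rw [← Finset.mul_sum]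
        congr 1
        rw [Finset.sum_add_distrib, Finset.sum_add_distrib, Finset.sum_add_distrib, ← Finset.mul_sum,
          ← Finset.mul_sum]
    _ ≤ 64 * (CK * bigP D ^ 2 * ell D ^ 36 + Real.exp 13 ^ 4 * (CN * bigP D ^ 2 * ell D ^ 36) +
          C' ^ 4 * (CE * bigP D ^ 2 * ell D ^ 36) + C' ^ 4 * 4 * (bigP D ^ 2 * ell D ^ 36)) := by
        have h13 : 0 ≤ Real.exp 13 ^ 4 := by positivity
        have hC4 : 0 ≤ C' ^ 4 := by positivity
        have := mul_le_mul_of_nonneg_left hSN h13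
        have := mul_le_mul_of_nonneg_left hSE hC4
        linarith
    _ = _ := by ring

/-- For large `D`: `α > 0` and the shift sizes satisfy `0 ≤ b₂ < 2`, `0 ≤ b₃ < 2` (`b₂ = 2α(1+c′α𝓛)`,
`b₃ = 3α(1−c′α𝓛)`, `α𝓛 = π𝓛⁻⁸`). [cite: Zhang2022LandauSiegel, §2 (2.10), (2.13)] -/
private theorem eventually_shifts (c' : ℝ) : ∃ D₀ : ℕ, ∀ D : ℕ, D₀ ≤ D →
    0 < alpha D ∧ 0 ≤ b2 c' D ∧ b2 c' D < 2 ∧ 0 ≤ b3 c' D ∧ b3 c' D < 2 := by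
  obtain ⟨D₀, h⟩ := eventually_ell (eventually_ge_atTop (5 * |c'| * π + 3))
  refine ⟨D₀, fun D hD => ?_⟩
  have hℓ : 5 * |c'| * π + 3 ≤ ell D := h D hD
  have hc0 : 0 ≤ 5 * |c'| * π := by positivity
  have hℓ3 : 3 ≤ ell D := by linarith
  have hℓ0 : 0 < ell D := by linarith
  have hℓ1 : 1 ≤ ell D := by linarith
  have hα : alpha D = π / ell D ^ 9 := by rw [alpha, bigP, Real.log_exp]
  have hαpos : 0 < alpha D := by rw [hα]; positivity
  have hα8 : alpha D ≤ 1 / 8 := by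
    have := two_alpha_le hℓ3
    linarith
  have hℓ8 : ell D ≤ ell D ^ 8 := le_self_pow₀ hℓ1 (by norm_num)
  have hαℓ : alpha D * ell D = π / ell D ^ 8 := by
    rw [hα]; field_simp
  have hkey : |c'| * (alpha D * ell D) ≤ 1 / 5 := by
    rw [hαℓ]
    have h1 : |c'| * (π / ell D ^ 8) ≤ |c'| * (π / ell D) :=
      mul_le_mul_of_nonneg_left (div_le_div_of_nonneg_left Real.pi_pos.le hℓ0 hℓ8) (abs_nonneg _)
    have h2 : |c'| * (π / ell D) ≤ 1 / 5 := by
      rw [← mul_div_assoc, div_le_iff₀ hℓ0]; linarith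
    exact h1.trans h2
  have hcb : |c' * (alpha D * ell D)| ≤ 1 / 5 := by
    rw [abs_mul, abs_of_nonneg (mul_pos hαpos hℓ0).le]; exact hkey
  obtain ⟨hcb1, hcb2⟩ := abs_le.mp hcb
  have e2 : b2 c' D = 2 * alpha D * (1 + c' * (alpha D * ell D)) := by rw [b2]; ring
  have e3 : b3 c' D = 3 * alpha D * (1 - c' * (alpha D * ell D)) := by rw [b3]; ring
  refine ⟨hαpos, ?_, ?_, ?_, ?_⟩
  · rw [e2]; apply mul_nonneg (by positivity); linarith
  · rw [e2]; nlinarith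
  · rw [e3]; apply mul_nonneg (by positivity); linarith
  · rw [e3]; nlinarith

/-- **`Z22:§8.u013` HOLDS, given Lemma 6.1 in its print-faithful (A)-form** (the cone leaf
`Skeleton.Lemma61A`, entering as a hypothesis; §8.u013 itself carries (A)): "By Cauchy's inequality,
Lemma 6.1, and the second assertion of Lemma 3.3, for `s ∈ 𝔍(α)`,
`Σ_{ψ∈Ψ₁} |L(s+β₂,ψ)L(s+β₃,ψ)|² ≪ P²𝓛³⁶`" — via `|L₂L₃|² ≤ ½(|L₂|⁴ + |L₃|⁴)` and the fourth moment
`fourth_moment_L` at `w = s + β_j` (`Re w = 1/2 + α`, `|Im w − 2πt₀| ≤ 𝓛₁ + b_j < 𝓛₁ + 2`).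
[cite: Zhang2022LandauSiegel, §8 p.43, tex L2244–2247] -/
theorem step8u013_ofA (h61 : Skeleton.Lemma61A) (c' : ℝ) : Step8u013 c' := by
  obtain ⟨C, D₀, hmain⟩ := fourth_moment_L h61
  obtain ⟨D₁, h₁⟩ := eventually_shifts c'
  refine ⟨C, max D₀ D₁, fun D _ χ hD hq hp hA s hs => ?_⟩
  have hD₀ : D₀ ≤ D := le_trans (le_max_left _ _) hD
  obtain ⟨hαpos, hb2, hb2', hb3, hb3'⟩ := h₁ D (le_trans (le_max_right _ _) hD)
  obtain ⟨v, hv, rfl⟩ := hs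
  obtain ⟨-, e2, e3⟩ := beta_eq_b_mul_I c' D
  obtain ⟨hv1, hv2⟩ := abs_le.mp hv
  have hre : ∀ b : ℝ, ((alpha D : ℂ) + s0 D + v * I + (b : ℂ) * I).re = 1 / 2 + alpha D := by
    intro b; rw [s0, SmoothWeight.s0_def]; simp; ring
  have him : ∀ b : ℝ, ((alpha D : ℂ) + s0 D + v * I + (b : ℂ) * I).im = 2 * π * t0 D + (v + b) := by
    intro b; rw [s0, SmoothWeight.s0_def]; simp; ring
  have hrange : ∀ b : ℝ, 0 ≤ b → b < 2 →
      |((alpha D : ℂ) + s0 D + v * I + (b : ℂ) * I).im - 2 * π * t0 D| < ell1 D + 2 := by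
    intro b hb0 hb2
    rw [him, show 2 * π * t0 D + (v + b) - 2 * π * t0 D = v + b by ring, abs_lt]
    constructor <;> linarith
  have h2 := hmain D χ hD₀ hq hp hA _ (hre (b2 c' D)) (hrange _ hb2 hb2')
  have h3 := hmain D χ hD₀ hq hp hA _ (hre (b3 c' D)) (hrange _ hb3 hb3')
  rw [← e2] at h2
  rw [← e3] at h3
  calc ∑ x ∈ finsetOf (PsiOne χ),
        ‖x.ψ.LFunction ((alpha D : ℂ) + s0 D + v * I + beta2 c' D) *
          x.ψ.LFunction ((alpha D : ℂ) + s0 D + v * I + beta3 c' D)‖ ^ 2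
      ≤ ∑ x ∈ finsetOf (PsiOne χ),
          (‖x.ψ.LFunction ((alpha D : ℂ) + s0 D + v * I + beta2 c' D)‖ ^ 4 +
            ‖x.ψ.LFunction ((alpha D : ℂ) + s0 D + v * I + beta3 c' D)‖ ^ 4) / 2 := by
        refine Finset.sum_le_sum fun x _ => ?_
        rw [norm_mul, mul_pow]
        nlinarith [sq_nonneg (‖x.ψ.LFunction ((alpha D : ℂ) + s0 D + v * I + beta2 c' D)‖ ^ 2 -
          ‖x.ψ.LFunction ((alpha D : ℂ) + s0 D + v * I + beta3 c' D)‖ ^ 2)]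
    _ = (∑ x ∈ finsetOf (PsiOne χ),
            ‖x.ψ.LFunction ((alpha D : ℂ) + s0 D + v * I + beta2 c' D)‖ ^ 4 +
          ∑ x ∈ finsetOf (PsiOne χ),
            ‖x.ψ.LFunction ((alpha D : ℂ) + s0 D + v * I + beta3 c' D)‖ ^ 4) / 2 := by
        rw [← Finset.sum_add_distrib, Finset.sum_div]
    _ ≤ (C * bigP D ^ 2 * ell D ^ 36 + C * bigP D ^ 2 * ell D ^ 36) / 2 := by
        gcongr
    _ = C * bigP D ^ 2 * ell D ^ 36 := by ring

/-- **`Z22:§8.u013` HOLDS, given the banked (unconditional) `Skeleton.Lemma61`** — through the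
bridge `Skeleton.lemma61A_of_lemma61`. [cite: Zhang2022LandauSiegel, §8 p.43, tex L2244–2247] -/
theorem step8u013_of (h61 : Skeleton.Lemma61) (c' : ℝ) : Step8u013 c' :=
  step8u013_ofA (Skeleton.lemma61A_of_lemma61 h61) c'

/-! ## F. The REFLECTED (A)-form of Lemma 6.1 (error `E₁(1 − s̄, ψ)`, GAP-LEDGER G-d08-2) also gives `Z22:§8.u013`

The §6 discharge chain of the tree proves Lemma 6.1 with the error functional at the reflected point
`1 − s̄` (`Section6Statements.lemma61_reflected_of_eq61R`, `eq63_reflected`; `Re(1 − s̄) = 1 − σ`,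
`Im(1 − s̄) = t`), not at `s` as printed. For the consumer §8.u013 this is immaterial: the fourth
moment of `E₁(u,ψ)` over `ψ` is `≪ P²𝓛³⁶` on the line `Re u = 1/2 − α` exactly as on `Re u = 1/2 + α`
— the same Hölder + large-sieve chain with the weight `n^{2α−1} ≤ e^{4π}n⁻¹` (`n ≤ P²`, `α log P = π`,
`weight_half_sub`) in place of `n^{−1−2α} ≤ n⁻¹`. Appended 2026-08-26 (sz-d22; L2 DISCHARGE LEDGER #12
R44/R46: "whether an `…_ofAR` twin is a one-liner"). [cite: Zhang2022LandauSiegel, §8 p.43, tex L2244–2247]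
-/

/-- **`Σ_{ψ∈T} E₁(u,ψ)⁴ ≪ P²𝓛³⁶` on `σ = 1/2 − α`** (the reflected line; any finite `T ⊆ Ψ`, large
`D`): Hölder in `v`, the sum over `ψ` inside the integral, the large sieve pointwise in `v` (length
`(T³)² ≤ P²`, weight `n^{2α−1} ≤ e^{4π}n⁻¹`, `ω₁ ≤ 1`); prefactor `𝓛⁻²⁷²(2𝓛²⁰)⁴ ≤ 16`.
[cite: Zhang2022LandauSiegel, §8 p.43, tex L2244–2247; §6 Lemma 6.1 p.30] -/
private theorem fourth_moment_E_refl : ∃ C : ℝ, ∃ D₀ : ℕ, ∀ D : ℕ, D₀ ≤ D →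
    ∀ (T : Finset (Chr D)) (u : ℂ), u.re = 1 / 2 - alpha D →
      ∑ x ∈ T, E1main x u ^ 4 ≤ C * bigP D ^ 2 * ell D ^ 36 := by
  obtain ⟨D₁, h₁⟩ := eventually_sizes
  refine ⟨(2 + 2 * (3 + (Real.log 2 ^ 68)⁻¹) ^ 2) * (256 * (Real.exp (4 * π) * majorantConst 4 4)), D₁,
    fun D hD T u hu => ?_⟩
  obtain ⟨hL3, -, hT3, hK2⟩ := h₁ D hD
  have hL0 : 0 < ell D := by linarith
  have hL1 : 1 ≤ ell D := by linarith
  have hα0 : 0 ≤ alpha D := by rw [alpha, bigP, Real.log_exp]; positivity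
  have hu0 : 0 ≤ u.re := by
    rw [hu]
    have := two_alpha_le hL3
    linarith
  have hT0 : 0 ≤ bigT D ^ 3 := by unfold bigT; positivity
  set L : ℝ := ell D ^ 20 with hLdef
  have hL20 : 0 ≤ L := by positivity
  set Nn := ⌈bigT D ^ 3⌉₊ with hNn
  set B : ℝ := (2 + 2 * (3 + (Real.log 2 ^ 68)⁻¹) ^ 2) * bigP D ^ 2 *
    (Real.exp (4 * π) * (majorantConst 4 4 * Real.log (⌊bigP D ^ 2⌋₊ : ℝ) ^ 4)) with hBdef
  -- the integrand of `E₁(u,ψ)`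
  set f : Chr D → ℝ → ℝ := fun x v =>
    ‖∑ n ∈ Finset.Ico 1 Nn, x.ψ (n : ZMod x.p) * (n : ℂ) ^ (-(u + v * I))‖ *
      Real.exp (-(v ^ 2) / (4 * ell D ^ 30)) with hfdef
  have hfc : ∀ x, Continuous (f x) := fun x => continuous_E1integrand x u
  have hf0 : ∀ x v, 0 ≤ f x v := fun x v => by positivity
  have hfM : ∀ x v, f x v ≤ ((Finset.Ico 1 Nn).card : ℝ) := fun x v => E1integrand_le x hu0 v
  -- the large sieve, pointwise in `v`
  have hB : ∀ v : ℝ, ∑ x ∈ T, f x v ^ 4 ≤ B := by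
    intro v
    have hre : (u + v * I).re = 1 / 2 - alpha D := by simp [hu]
    have hmain := fourth_moment_le T (len_sq_le hT0 hT3) hK2 (fun _ => (1 : ℂ)) (B := 1)
      (fun n => by simp) (u + v * I) (fun k hk => weight_half_sub hL0 hre k hk)
    simp only [one_mul, max_eq_left (zero_le_one (α := ℝ)), one_pow] at hmain
    refine le_trans (Finset.sum_le_sum fun x _ => ?_) hmain
    have hexp : Real.exp (-(v ^ 2) / (4 * ell D ^ 30)) ≤ 1 := by
      rw [Real.exp_le_one_iff, neg_div]
      exact neg_nonpos.mpr (by positivity)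
    have hS := norm_nonneg (∑ n ∈ Finset.Ico 1 Nn, x.ψ (n : ZMod x.p) * (n : ℂ) ^ (-(u + v * I)))
    calc f x v ^ 4 ≤ (‖∑ n ∈ Finset.Ico 1 Nn, x.ψ (n : ZMod x.p) * (n : ℂ) ^ (-(u + v * I))‖ * 1) ^ 4 := by
          apply pow_le_pow_left₀ (hf0 x v)
          exact mul_le_mul_of_nonneg_left hexp hS
      _ = _ := by rw [mul_one]
  -- Hölder, per `ψ`
  have hH : ∀ x ∈ T, E1main x u ^ 4 ≤
      (ell D ^ 68)⁻¹ ^ 4 * ((2 * L) ^ 3 * ∫ v in (-L)..L, f x v ^ 4) := by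
    intro x _
    have hE : E1main x u = (ell D ^ 68)⁻¹ * ∫ v in (-L)..L, f x v := rfl
    rw [hE, mul_pow]
    exact mul_le_mul_of_nonneg_left (integral_pow_four_le (hfc x) (hf0 x) (hfM x) hL20)
      (by positivity)
  -- interval integrability of the fourth powers and their sum
  have hfi : ∀ x ∈ T, IntervalIntegrable (fun v => f x v ^ 4) volume (-L) L :=
    fun x _ => ((hfc x).pow 4).intervalIntegrable _ _
  have hLL : -L ≤ L := by linarith
  calc ∑ x ∈ T, E1main x u ^ 4
      ≤ ∑ x ∈ T, (ell D ^ 68)⁻¹ ^ 4 * ((2 * L) ^ 3 * ∫ v in (-L)..L, f x v ^ 4) :=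
        Finset.sum_le_sum hH
    _ = (ell D ^ 68)⁻¹ ^ 4 * ((2 * L) ^ 3 * ∫ v in (-L)..L, ∑ x ∈ T, f x v ^ 4) := by
        rw [intervalIntegral.integral_finsetSum hfi, Finset.mul_sum, Finset.mul_sum]
    _ ≤ (ell D ^ 68)⁻¹ ^ 4 * ((2 * L) ^ 3 * ∫ _ in (-L)..L, B) := by
        apply mul_le_mul_of_nonneg_left _ (by positivity)
        apply mul_le_mul_of_nonneg_left _ (by positivity)
        exact intervalIntegral.integral_mono_on hLL
          ((continuous_finsetSum T fun x _ => (hfc x).pow 4).intervalIntegrable _ _)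
          intervalIntegrable_const (fun v _ => hB v)
    _ = (ell D ^ 68)⁻¹ ^ 4 * (2 * L) ^ 4 * B := by
        rw [intervalIntegral.integral_const, smul_eq_mul]; ring
    _ ≤ 16 * B := by
        have hB0 : 0 ≤ B := by
          rw [hBdef]
          have := (majorantConst_pos 4 4).le
          have hlog : 0 ≤ Real.log (⌊bigP D ^ 2⌋₊ : ℝ) :=
            Real.log_nonneg (by exact_mod_cast (by omega : 1 ≤ ⌊bigP D ^ 2⌋₊))
          positivity
        apply mul_le_mul_of_nonneg_right _ hB0
        have hℓ : ell D ≠ 0 := hL0.ne'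
        have h1 : (ell D ^ 68)⁻¹ ^ 4 * (2 * L) ^ 4 = 16 * (ell D ^ 192)⁻¹ := by
          rw [hLdef]; field_simp; ring
        rw [h1]
        have h2 : (ell D ^ 192)⁻¹ ≤ 1 := inv_le_one_of_one_le₀ (one_le_pow₀ hL1)
        linarith
    _ ≤ _ := by
        rw [hBdef]
        have hlog := log_floor_pow_four_le hK2
        have hmc := (majorantConst_pos 4 4).le
        have he := (Real.exp_pos (4 * π)).le
        calc 16 * ((2 + 2 * (3 + (Real.log 2 ^ 68)⁻¹) ^ 2) * bigP D ^ 2 *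
              (Real.exp (4 * π) * (majorantConst 4 4 * Real.log (⌊bigP D ^ 2⌋₊ : ℝ) ^ 4)))
            ≤ 16 * ((2 + 2 * (3 + (Real.log 2 ^ 68)⁻¹) ^ 2) * bigP D ^ 2 *
              (Real.exp (4 * π) * (majorantConst 4 4 * (16 * ell D ^ 36)))) := by
              apply mul_le_mul_of_nonneg_left _ (by norm_num)
              exact mul_le_mul_of_nonneg_left (mul_le_mul_of_nonneg_left
                (mul_le_mul_of_nonneg_left hlog hmc) he) (by positivity)
          _ = _ := by ring

/-- **`Σ_{ψ∈Ψ₁} |L(w,ψ)|⁴ ≪ P²𝓛³⁶`** for `Re w = 1/2 + α`, `|Im w − 2πt₀| < 𝓛₁ + 2`, all large `D` and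
real primitive `χ (mod D)` satisfying (A), GIVEN Lemma 6.1 in the REFLECTED (A)-form
`|L(w,ψ) − K(w,ψ) − Z(w,ψ)N(1−w,ψ̄)| ≤ C(E₁(1−w̄,ψ) + ε)` (the exact conclusion of
`Section6Statements.lemma61_reflected_of_eq61R`): `|Z| ≤ e¹³`, `(a+b+c+d)⁴ ≤ 64Σa⁴`, the fourth
moments `fourth_moment_K` (at `w`), `fourth_moment_N` and `fourth_moment_E_refl` (both at
`1 − w̄`, `Re = 1/2 − α`), and `#Ψ₁ ≤ 𝔓 ≤ 4P²` for the `ε`-term.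
[cite: Zhang2022LandauSiegel, §8 p.43, tex L2244–2247] -/
private theorem fourth_moment_L_refl
    (h61 : ∃ c : ℝ, 0 < c ∧ ∃ C : ℝ, ForAllLarge fun D _ χ => AssumptionA D χ → ∀ x : Chr D,
      ∀ s : ℂ, |s.re - 1 / 2| < 2 * alpha D → |s.im - 2 * π * t0 D| < ell1 D + 2 →
        ‖x.ψ.LFunction s - Kchar D (psiFn x) s -
            GammaFactor.Zfac x.ψ s * Nchar D (psiBarFn x) (1 - s)‖
          ≤ C * (E1main x (1 - conj s) + Real.exp (-c * ell D ^ 10))) :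
    ∃ C : ℝ, ∃ D₀ : ℕ,
    ∀ (D : ℕ) [NeZero D] (χ : DirichletCharacter ℂ D), D₀ ≤ D → χ.IsQuadratic → χ.IsPrimitive →
      AssumptionA D χ → ∀ w : ℂ, w.re = 1 / 2 + alpha D → |w.im - 2 * π * t0 D| < ell1 D + 2 →
        ∑ x ∈ finsetOf (PsiOne χ), ‖x.ψ.LFunction w‖ ^ 4 ≤ C * bigP D ^ 2 * ell D ^ 36 := by
  obtain ⟨c, hc, C61, D61, h61'⟩ := h61
  obtain ⟨CK, DK, hK⟩ := fourth_moment_K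
  obtain ⟨CN, DN, hN⟩ := fourth_moment_N
  obtain ⟨CE, DE, hE⟩ := fourth_moment_E_refl
  obtain ⟨D₁, h₁⟩ := eventually_sizes
  obtain ⟨DP, hP⟩ := eventually_frakP_le
  set C' : ℝ := max C61 0 with hC'
  refine ⟨64 * (CK + Real.exp 13 ^ 4 * CN + C' ^ 4 * CE + C' ^ 4 * 4),
    max (max (max D61 DK) (max DN DE)) (max D₁ DP), fun D _ χ hD hq hp hA w hw him => ?_⟩
  have hD61 : D61 ≤ D := le_trans (le_trans (le_trans (le_max_left _ _) (le_max_left _ _)) (le_max_left _ _)) hD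
  have hDK : DK ≤ D := le_trans (le_trans (le_trans (le_max_right _ _) (le_max_left _ _)) (le_max_left _ _)) hD
  have hDN : DN ≤ D := le_trans (le_trans (le_trans (le_max_left _ _) (le_max_right _ _)) (le_max_left _ _)) hD
  have hDE : DE ≤ D := le_trans (le_trans (le_trans (le_max_right _ _) (le_max_right _ _)) (le_max_left _ _)) hD
  have hD₁ : D₁ ≤ D := le_trans (le_trans (le_max_left _ _) (le_max_right _ _)) hD
  have hDP : DP ≤ D := le_trans (le_trans (le_max_right _ _) (le_max_right _ _)) hD
  obtain ⟨hL3, -, -, -⟩ := h₁ D hD₁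
  have hL1 : 1 ≤ ell D := by linarith
  have hαpos : 0 < alpha D := by rw [alpha, bigP, Real.log_exp]; positivity
  have hσ : |w.re - 1 / 2| < 2 * alpha D := by
    rw [hw, show 1 / 2 + alpha D - 1 / 2 = alpha D by ring, abs_of_pos hαpos]; linarith
  have hu : (conj (1 - w)).re = 1 / 2 - alpha D := by simp [hw]; ring
  have hu' : (1 - conj w).re = 1 / 2 - alpha D := by simp [hw]; ring
  set T := finsetOf (PsiOne χ) with hT
  set ε : ℝ := Real.exp (-c * ell D ^ 10) with hε
  have hε0 : 0 ≤ ε := (Real.exp_pos _).le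
  have hC'0 : 0 ≤ C' := le_max_right _ _
  -- Lemma 6.1 (reflected form), per `ψ`
  have hLψ : ∀ x : Chr D, ‖x.ψ.LFunction w‖ ≤ ‖Kchar D (psiFn x) w‖ +
      Real.exp 13 * ‖Nchar D (psiFn x) (conj (1 - w))‖ + C' * E1main x (1 - conj w) + C' * ε := by
    intro x
    have h := h61' D χ hD61 hq hp hA x w hσ him
    have hZ := norm_Zfac_le_exp13 hL3 x hσ him
    have hE0 := E1main_nonneg x (1 - conj w)
    have hR : ‖x.ψ.LFunction w - Kchar D (psiFn x) w -
        GammaFactor.Zfac x.ψ w * Nchar D (psiBarFn x) (1 - w)‖ ≤ C' * (E1main x (1 - conj w) + ε) :=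
      h.trans (mul_le_mul_of_nonneg_right (le_max_left _ _) (by positivity))
    have hZN : ‖GammaFactor.Zfac x.ψ w * Nchar D (psiBarFn x) (1 - w)‖ ≤
        Real.exp 13 * ‖Nchar D (psiFn x) (conj (1 - w))‖ := by
      rw [norm_mul, norm_Nchar_bar]
      exact mul_le_mul_of_nonneg_right hZ (norm_nonneg _)
    calc ‖x.ψ.LFunction w‖
        = ‖(x.ψ.LFunction w - Kchar D (psiFn x) w -
              GammaFactor.Zfac x.ψ w * Nchar D (psiBarFn x) (1 - w)) +
            Kchar D (psiFn x) w + GammaFactor.Zfac x.ψ w * Nchar D (psiBarFn x) (1 - w)‖ := by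
          congr 1; ring
      _ ≤ ‖x.ψ.LFunction w - Kchar D (psiFn x) w -
              GammaFactor.Zfac x.ψ w * Nchar D (psiBarFn x) (1 - w)‖ +
            ‖Kchar D (psiFn x) w‖ + ‖GammaFactor.Zfac x.ψ w * Nchar D (psiBarFn x) (1 - w)‖ :=
          norm_add₃_le
      _ ≤ C' * (E1main x (1 - conj w) + ε) + ‖Kchar D (psiFn x) w‖ +
            Real.exp 13 * ‖Nchar D (psiFn x) (conj (1 - w))‖ := by linarith
      _ = _ := by ring
  -- fourth powers, per `ψ`
  have hL4 : ∀ x : Chr D, ‖x.ψ.LFunction w‖ ^ 4 ≤ 64 * (‖Kchar D (psiFn x) w‖ ^ 4 +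
      Real.exp 13 ^ 4 * ‖Nchar D (psiFn x) (conj (1 - w))‖ ^ 4 + C' ^ 4 * E1main x (1 - conj w) ^ 4 +
        C' ^ 4 * ε ^ 4) := by
    intro x
    calc ‖x.ψ.LFunction w‖ ^ 4 ≤ (‖Kchar D (psiFn x) w‖ +
          Real.exp 13 * ‖Nchar D (psiFn x) (conj (1 - w))‖ + C' * E1main x (1 - conj w) + C' * ε) ^ 4 :=
          pow_le_pow_left₀ (norm_nonneg _) (hLψ x) 4
      _ ≤ 64 * (‖Kchar D (psiFn x) w‖ ^ 4 + (Real.exp 13 * ‖Nchar D (psiFn x) (conj (1 - w))‖) ^ 4 +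
            (C' * E1main x (1 - conj w)) ^ 4 + (C' * ε) ^ 4) := add_pow_four_le _ _ _ _
      _ = _ := by ring
  -- the four sums
  have hSK := hK D hDK T w hw
  have hSN := hN D hDN T (conj (1 - w)) hu
  have hSE := hE D hDE T (1 - conj w) hu'
  have hcard : (T.card : ℝ) ≤ 4 * bigP D ^ 2 := (cardPsiOneLe_holds D χ).trans (hP D hDP)
  have hε1 : ε ^ 4 ≤ 1 := by
    apply pow_le_one₀ hε0
    rw [hε, Real.exp_le_one_iff, neg_mul]
    exact neg_nonpos.mpr (by positivity)
  have hX : bigP D ^ 2 ≤ bigP D ^ 2 * ell D ^ 36 :=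
    le_mul_of_one_le_right (by positivity) (one_le_pow₀ hL1)
  have hlast : ∑ x ∈ T, C' ^ 4 * ε ^ 4 ≤ C' ^ 4 * 4 * (bigP D ^ 2 * ell D ^ 36) := by
    rw [Finset.sum_const, nsmul_eq_mul]
    have h1 : (T.card : ℝ) * (C' ^ 4 * ε ^ 4) ≤ (4 * bigP D ^ 2) * (C' ^ 4 * 1) :=
      mul_le_mul hcard (mul_le_mul_of_nonneg_left hε1 (by positivity)) (by positivity) (by positivity)
    have h2 : 0 ≤ C' ^ 4 := by positivity
    nlinarith
  calc ∑ x ∈ T, ‖x.ψ.LFunction w‖ ^ 4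
      ≤ ∑ x ∈ T, 64 * (‖Kchar D (psiFn x) w‖ ^ 4 +
          Real.exp 13 ^ 4 * ‖Nchar D (psiFn x) (conj (1 - w))‖ ^ 4 +
            C' ^ 4 * E1main x (1 - conj w) ^ 4 + C' ^ 4 * ε ^ 4) := Finset.sum_le_sum fun x _ => hL4 x
    _ = 64 * (∑ x ∈ T, ‖Kchar D (psiFn x) w‖ ^ 4 +
          Real.exp 13 ^ 4 * ∑ x ∈ T, ‖Nchar D (psiFn x) (conj (1 - w))‖ ^ 4 +
          C' ^ 4 * ∑ x ∈ T, E1main x (1 - conj w) ^ 4 + ∑ x ∈ T, C' ^ 4 * ε ^ 4) := by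
        rw [← Finset.mul_sum]
        congr 1
        rw [Finset.sum_add_distrib, Finset.sum_add_distrib, Finset.sum_add_distrib, ← Finset.mul_sum,
          ← Finset.mul_sum]
    _ ≤ 64 * (CK * bigP D ^ 2 * ell D ^ 36 + Real.exp 13 ^ 4 * (CN * bigP D ^ 2 * ell D ^ 36) +
          C' ^ 4 * (CE * bigP D ^ 2 * ell D ^ 36) + C' ^ 4 * 4 * (bigP D ^ 2 * ell D ^ 36)) := by
        have h13 : 0 ≤ Real.exp 13 ^ 4 := by positivity
        have hC4 : 0 ≤ C' ^ 4 := by positivity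
        have := mul_le_mul_of_nonneg_left hSN h13
        have := mul_le_mul_of_nonneg_left hSE hC4
        linarith
    _ = _ := by ring

/-- **`Z22:§8.u013` HOLDS, given Lemma 6.1 in the REFLECTED (A)-form** — the error functional at
`1 − s̄` (the exact conclusion binder of `Section6Statements.lemma61_reflected_of_eq61R`, which the §6
chain of the tree discharges outright; GAP-LEDGER G-d08-2): "By Cauchy's inequality, Lemma 6.1, and the
second assertion of Lemma 3.3, for `s ∈ 𝔍(α)`, `Σ_{ψ∈Ψ₁} |L(s+β₂,ψ)L(s+β₃,ψ)|² ≪ P²𝓛³⁶`" — via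
`|L₂L₃|² ≤ ½(|L₂|⁴ + |L₃|⁴)` and `fourth_moment_L_refl` at `w = s + β_j` (`Re w = 1/2 + α`,
`|Im w − 2πt₀| ≤ 𝓛₁ + b_j < 𝓛₁ + 2`). The `…_ofAR` twin of `step8u013_ofA`.
[cite: Zhang2022LandauSiegel, §8 p.43, tex L2244–2247] -/
theorem step8u013_ofAR
    (h61R : ∃ c : ℝ, 0 < c ∧ ∃ C : ℝ, ForAllLarge fun D _ χ => AssumptionA D χ → ∀ x : Chr D,
      ∀ s : ℂ, |s.re - 1 / 2| < 2 * alpha D → |s.im - 2 * π * t0 D| < ell1 D + 2 →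
        ‖x.ψ.LFunction s - Kchar D (psiFn x) s -
            GammaFactor.Zfac x.ψ s * Nchar D (psiBarFn x) (1 - s)‖
          ≤ C * (E1main x (1 - conj s) + Real.exp (-c * ell D ^ 10)))
    (c' : ℝ) : Step8u013 c' := by
  obtain ⟨C, D₀, hmain⟩ := fourth_moment_L_refl h61R
  obtain ⟨D₁, h₁⟩ := eventually_shifts c'
  refine ⟨C, max D₀ D₁, fun D _ χ hD hq hp hA s hs => ?_⟩
  have hD₀ : D₀ ≤ D := le_trans (le_max_left _ _) hD
  obtain ⟨hαpos, hb2, hb2', hb3, hb3'⟩ := h₁ D (le_trans (le_max_right _ _) hD)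
  obtain ⟨v, hv, rfl⟩ := hs
  obtain ⟨-, e2, e3⟩ := beta_eq_b_mul_I c' D
  obtain ⟨hv1, hv2⟩ := abs_le.mp hv
  have hre : ∀ b : ℝ, ((alpha D : ℂ) + s0 D + v * I + (b : ℂ) * I).re = 1 / 2 + alpha D := by
    intro b; rw [s0, SmoothWeight.s0_def]; simp; ring
  have him : ∀ b : ℝ, ((alpha D : ℂ) + s0 D + v * I + (b : ℂ) * I).im = 2 * π * t0 D + (v + b) := by
    intro b; rw [s0, SmoothWeight.s0_def]; simp; ring
  have hrange : ∀ b : ℝ, 0 ≤ b → b < 2 →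
      |((alpha D : ℂ) + s0 D + v * I + (b : ℂ) * I).im - 2 * π * t0 D| < ell1 D + 2 := by
    intro b hb0 hb2
    rw [him, show 2 * π * t0 D + (v + b) - 2 * π * t0 D = v + b by ring, abs_lt]
    constructor <;> linarith
  have h2 := hmain D χ hD₀ hq hp hA _ (hre (b2 c' D)) (hrange _ hb2 hb2')
  have h3 := hmain D χ hD₀ hq hp hA _ (hre (b3 c' D)) (hrange _ hb3 hb3')
  rw [← e2] at h2
  rw [← e3] at h3
  calc ∑ x ∈ finsetOf (PsiOne χ),
        ‖x.ψ.LFunction ((alpha D : ℂ) + s0 D + v * I + beta2 c' D) *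
          x.ψ.LFunction ((alpha D : ℂ) + s0 D + v * I + beta3 c' D)‖ ^ 2
      ≤ ∑ x ∈ finsetOf (PsiOne χ),
          (‖x.ψ.LFunction ((alpha D : ℂ) + s0 D + v * I + beta2 c' D)‖ ^ 4 +
            ‖x.ψ.LFunction ((alpha D : ℂ) + s0 D + v * I + beta3 c' D)‖ ^ 4) / 2 := by
        refine Finset.sum_le_sum fun x _ => ?_
        rw [norm_mul, mul_pow]
        nlinarith [sq_nonneg (‖x.ψ.LFunction ((alpha D : ℂ) + s0 D + v * I + beta2 c' D)‖ ^ 2 -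
          ‖x.ψ.LFunction ((alpha D : ℂ) + s0 D + v * I + beta3 c' D)‖ ^ 2)]
    _ = (∑ x ∈ finsetOf (PsiOne χ),
            ‖x.ψ.LFunction ((alpha D : ℂ) + s0 D + v * I + beta2 c' D)‖ ^ 4 +
          ∑ x ∈ finsetOf (PsiOne χ),
            ‖x.ψ.LFunction ((alpha D : ℂ) + s0 D + v * I + beta3 c' D)‖ ^ 4) / 2 := by
        rw [← Finset.sum_add_distrib, Finset.sum_div]
    _ ≤ (C * bigP D ^ 2 * ell D ^ 36 + C * bigP D ^ 2 * ell D ^ 36) / 2 := by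
        gcongr
    _ = C * bigP D ^ 2 * ell D ^ 36 := by ring

end Literature.NumberTheory.LFunctions.Zhang2022.Section8aStatements

end
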